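import Literature.Computability.AlgebraicComplexity.LR17ExteriorDetReprEquivariance
import HarnessLib

/-!
# LR17 Prop. 2.17 — the regular, fully equivariant exterior-algebra representation of `det_m`;
# discharge of `lr_prop_2_17`

Topic `Literature/Computability/AlgebraicComplexity`. Companion (proofs only; no definitions, no
named facts) of `LR17EquivariantRepresentations.lean`, where Landsberg–Ressayre's Prop. 2.17
(arXiv:1508.05788, p0007:L73–L93; Differential Geom. Appl. 55 (2017) 146–166) is vended as the matrix
`LR17.detFullMatrix k m c` on `LR17.FullIdx m = {(S₁,S₂) : |S₁| = |S₂| < m}`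
(`ℂⁿ = ⊕_{j<m} ΛʲE ⊗ ΛʲF*`, `n = C(2m,m) - 1`, basis `e_{S₁} ⊗ f_{S₂}`):
`Ã = c Λ₀ + Σ_k EX_k` — the scalar `c` on the diagonal at levels `≥ 1` and the doubly Koszul-signed
variable `ε(S₁,i) ε(S₂,j) x_{ij}` in row `(S₁ ∪ i, S₂ ∪ j)` (top level wrapped to `(∅, ∅)`), column
`(S₁, S₂)` — with the printed scalar `c = LR17.lamScale m = (m!)^{-1/(n-m)}` in the named fact
`lr_prop_2_17` ("Then `(-1)^{m+1} det_m = det_n ∘ Ã`", a REGULAR representation that respects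
`𝔾_{det_m}`). Here that fact is DISCHARGED: `lr_prop_2_17_holds : lr_prop_2_17`; consequently
Thm. 2.13's upper half holds unconditionally (`LR17.hasRegularEquivariantDetRepr_detPoly_full`:
`srdc(det_m) ≤ C(2m,m) - 1`) and Thm. 2.13 is an equality modulo the lower-bound fact `lr_thm_2_13_ge`
only (`LR17.regularEquivariantDetComplexity_detPoly_full_eq`).

## The printed proof (§4.2, p0013:L41–L109) and how it is followed
* **Determinant** (p0013:L72–L81: "specialize to the diagonal matrices … this upper-left corner is
  exactly Grenet's representation for `perm_m(y…)` which is `m!(y¹₁⋯yᵐₘ)`. Finally note that each term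
  in an expansion contains `n - m` elements of `Λ₀`"). The paper first gets "`det_n ∘ Ã` is a multiple
  of `det_m`" from the equivariance and then fixes the multiple on diagonal matrices. DEVIATION (same
  content, direct route, as for Prop. 2.16 in `LR17ExteriorDetReprProofs.lean`): the expansion is
  carried out in full — after scaling the rows of `Ãᵀ` at levels `≥ 1` by `c⁻¹`, `Ãᵀ` is the block,
  on the balanced proper pairs, of the unipotent matrix `1 - A` of the BALANCED-PAIRS branching
  program (arcs `(S₁,S₂) → (S₁∪i, S₂∪j)`, here with the node-dependent weights
  `-c^{-[S₁≠∅]} ε(S₁,i) ε(S₂,j) x_{ij}`) with its row `snk = (univ,univ)` replaced by the unit row at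
  `src = (∅,∅)` and its columns `src`, `snk` swapped; so `c^{-(n-1)} det Ã = -adj(1 - A)_{src,snk}`,
  minus the full path sum (`LR17.pairArc_adjugate_one_sub_src_snk`, the pairs version — with
  node-dependent weights — of the tree's `Grenet.arc_adjugate_one_sub_empty_univ` and
  `LRPairs.adjugate_one_sub_src_snk`), i.e. the sum over PAIRS of orderings `(σ, τ)` of
  `(-1)^m c^{-(m-1)} ∏ₜ ε(σ{<t},σ t) ∏ₜ ε(τ{<t},τ t) ∏ₜ x_{σ t,τ t}`; the Koszul signs along a maximal
  chain multiply to `(-1)^{m(m-1)/2} sign` (`LR17.prod_koszulSign_prefix`, Prop. 2.16's companion), the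
  two fixed signs cancel, and `Σ_{σ,τ} sign σ sign τ ∏ₜ x_{σt,τt} = m! det_m` (each permutation arises
  from `m!` pairs of orderings, `LR17.sum_perm_perm_sign_prod`) — whence
  **`det Ã = (-1)^{m+1} c^{n-m} m! det_m`** for every `c ≠ 0` over any field
  (`LR17.det_detFullMatrix`), and `c^{n-m} m! = 1` for the printed `c` (`LR17.lamScale_pow_mul_factorial`).
* **Regularity**: `Ã(0) = c Λ₀ = diag(0, c, …, c)` has rank `n - 1` (`LR17.isRegularDetRepr_detFullMatrix`).
* **`GL(E) × GL(F)`** (p0013:L44–L71: "these identifications determine `GL(E) × GL(F)`-equivariant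
  polynomial maps … As in the proof of Proposition 2.16, this implies that `GL(E) × GL(F)` belongs to
  the image of `ρ̄_A`"). In coordinates, exactly as for Prop. 2.16 (`LR17ExteriorDetReprEquivariance.lean`,
  whose private minor/wedge toolkit is repeated here privately): the substitution `x ↦ (g ⊗ 1)·x`
  multiplies every column `x_{•j}` by `G = gᵀ`; writing `Ã = [E (c + N(x))]_bal` (`N` the arc matrix of
  the lattice of ALL pairs of subsets, `E` the identity with the row of `(∅,∅)` replaced by the row of
  `(univ,univ)`, `[·]_bal` the block of the balanced proper pairs; `fullShape_eq_block`) and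
  `𝕄 = M(G) ⊗ 1` (`M(G)` = block matrix of minors of `G`), the wedge intertwining
  `W(Gv) M = M W(v)` in the first tensor factor gives `N(Gx) 𝕄 = 𝕄 N(x)` (`pairArcs_mul_minor`),
  `E 𝕄 = (𝕄 𝔻) E` with `𝔻 = diag(det G at (∅,∅), 1)` (`pairWrapRow_mul_minor`), the blocks of `𝕄`
  against the non-balanced / top pairs vanish (`pairBlock_mul_minor`), hence
  `Ã((g⊗1)·x) Q = P Ã(x)` with `Q = [M(gᵀ) ⊗ 1]_bal = (⊕_{j<m} ∧ʲgᵀ) ⊗ 1`, `P = Q 𝔻`, `Q⁻¹` from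
  Cauchy–Binet (`Literature.LinearAlgebra.Matrix.compound_mul`) — `exists_lift_left`. The RIGHT
  multiplications need no second computation: `1 ⊗ h = τ (h ⊗ 1) τ` for the transposition permutation
  `τ`, so `detSymmetrySubst k m ≤ closure({g ⊗ 1} ∪ {τ})`
  (`LR17.detSymmetrySubst_le_closure_left_transpose`) and `IsEquivariantDetRepr.anti` applies.
* **Transposition** (p0013:L83–L109: "there exist two permutation matrices `B₁, B₂ ∈ GL_n(ℂ)` such
  that `Ã(Mᵀ) = B₁ Ã(M) B₂⁻¹`"): `Ã(xᵀ)` is `Ã(x)` with rows and columns relabelled by the swap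
  `(S₁,S₂) ↦ (S₂,S₁)` (`detFullMatrix_map_transpose`, the two Koszul signs commute), so after transport
  along `e : FullIdx m ≃ Fin n` it is `P_α Ã P_α⁻¹` (`exists_lift_transpose`).
Everything is assembled by `IsEquivariantDetRepr.of_generators` (`LR17.isEquivariantDetRepr_detFullMatrix`,
any field, any `c ≠ 0`, any indexing `e`). Honest framing (cell `val-lit`): a discharge of printed
content; nothing here bears on `VP ≠ VNP` beyond what Landsberg–Ressayre print.

## Main statements
* `LR17.det_detFullMatrix`, `LR17.isRegularDetRepr_detFullMatrix`, `LR17.isEquivariantDetRepr_detFullMatrix`;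
* `lr_prop_2_17_holds : lr_prop_2_17` — **the discharge** (over `ℂ`, printed scalar);
* `LR17.hasRegularEquivariantDetRepr_detPoly_full` — Thm. 2.13, upper half, unconditionally;
  `LR17.regularEquivariantDetComplexity_detPoly_full_eq (hge : lr_thm_2_13_ge)` — Thm. 2.13 as an equality.
* Reusable: `LR17.pairArc_pow_apply` / `_det_one_sub` / `_adjugate_one_sub(_src_snk)` (path calculus of
  the balanced-pairs program with node-dependent arc weights), `LR17.sum_perm_perm_sign_prod`,
  `LR17.detSymmetrySubst_le_closure_left_transpose`, `LR17.lamScale_pow_mul_factorial`, `LR17.lamScale_ne_zero`.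

## References
* [LandsbergRessayre2017] J. M. Landsberg, N. Ressayre, *Permanent v. determinant: an exponential
  lower bound assuming symmetry and a potential path towards Valiant's conjecture*, Differential
  Geom. Appl. 55 (2017) 146–166, arXiv:1508.05788, Prop. 2.17 (p0007:L73–L93), §4.2 (p0013:L41–L109),
  Thm. 2.13 (p0006:L127–L129).
* [Grenet2012Thesis] B. Grenet, PhD thesis, ENS Lyon (2012), Lemme 3.17 (path sums of the subset
  lattice; the tree's `GrenetWeightedPaths.lean`, `LandsbergRessayrePairsProgram.lean`).
* [Bernstein2009] D. S. Bernstein, *Matrix Mathematics*, 2nd ed. (2009), Fact 7.5.17 (vi) (Binet–Cauchy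
  for compound matrices; the tree's `Literature/LinearAlgebra/Matrix/SylvesterFranke.lean`).
-/

noncomputable section

open Matrix MvPolynomial Finset
open scoped Kronecker

namespace Literature.Computability.AlgebraicComplexity

namespace LR17

/-! ### Paths in the balanced-pairs program with node-dependent arc weights -/

section PairsPaths

variable {α : Type*} [Fintype α] [DecidableEq α] {R : Type*} [CommRing R]

omit [DecidableEq α] in
/-- Splitting a sum over `Fin (n+1) → α` along `Fin.cons`. [folklore] -/
private theorem sum_cons {n : ℕ} (G : (Fin (n + 1) → α) → R) :
    ∑ g, G g = ∑ i : α, ∑ g : Fin n → α, G (Fin.cons i g) := by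
  rw [← Fintype.sum_prod_type']
  exact (Fintype.sum_equiv (Fin.consEquiv fun _ => α) (fun p => G (Fin.cons p.1 p.2)) G
    (fun _ => rfl)).symm

omit [Fintype α] in
/-- The one-sided path condition along `Fin.cons`. [folklore] -/
private theorem cons_cond_iff [Fintype α] (P Q : Finset α) {n : ℕ} (i : α) (g : Fin n → α) :
    (Function.Injective (Fin.cons i g : Fin (n + 1) → α) ∧
        (∀ t, (Fin.cons i g : Fin (n + 1) → α) t ∉ P) ∧
          P ∪ univ.image (Fin.cons i g : Fin (n + 1) → α) = Q) ↔
      (i ∉ P ∧ (Function.Injective g ∧ (∀ t, g t ∉ insert i P) ∧ insert i P ∪ univ.image g = Q)) := by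
  have hcons_image : univ.image (Fin.cons i g : Fin (n + 1) → α) = insert i (univ.image g) := by
    ext a
    simp [Fin.exists_fin_succ, eq_comm]
  simp only [Fin.cons_injective_iff, Fin.forall_fin_succ, Fin.cons_zero, Fin.cons_succ,
    hcons_image, Set.mem_range, not_exists, mem_insert, not_or, forall_and, union_insert,
    insert_union]
  tauto

omit [Fintype α] in
/-- Prefix sets along `Fin.cons`: the empty prefix, and the shifted prefixes. [folklore] -/
private theorem union_prefix_cons_zero [Fintype α] (P : Finset α) {n : ℕ} (g : Fin (n + 1) → α) :
    P ∪ (univ.filter fun i : Fin (n + 1) => (i : ℕ) < ((0 : Fin (n + 1)) : ℕ)).image g = P := by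
  simp

omit [Fintype α] in
/-- Prefix sets along `Fin.cons`: the shifted prefixes. [folklore] -/
private theorem union_prefix_cons_succ [Fintype α] (P : Finset α) {n : ℕ} (i : α) (g : Fin n → α)
    (t : Fin n) :
    P ∪ (univ.filter fun s : Fin (n + 1) => (s : ℕ) < (t.succ : ℕ)).image
        (Fin.cons i g : Fin (n + 1) → α) =
      insert i P ∪ (univ.filter fun s : Fin n => (s : ℕ) < t).image g := by
  ext a
  simp only [mem_union, mem_insert, mem_image, mem_filter, mem_univ, true_and,
    Fin.exists_fin_succ, Fin.cons_zero, Fin.cons_succ, Fin.val_zero, Fin.val_succ,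
    Nat.succ_lt_succ_iff, Nat.zero_lt_succ]
  tauto

/-- **Paths in the pairs program with node-dependent weights.** Let `A` be the weighted adjacency
matrix on the balanced pairs `(I, J)` (`|I| = |J|`) of subsets of `α`: an arc
`(I, J) → (insert i I, insert j J)` of weight `w I J i j` for `i ∉ I`, `j ∉ J`. Then `(Aⁿ) P Q` is
the sum over the pairs `(g, h)` of injective sequences `Fin n → α` — `g` avoiding `P.1` with
`P.1 ∪ im g = Q.1`, `h` avoiding `P.2` with `P.2 ∪ im h = Q.2` — of the path products
`∏ₜ w (P.1 ∪ g({i<t})) (P.2 ∪ h({i<t})) (g t) (h t)` (the pairs version of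
`Grenet.arc_pow_apply`; `LRPairs.pow_apply` is the case of node-independent weights).
[cite: LandsbergRessayre2017, Prop. 2.17] -/
theorem pairArc_pow_apply (w : Finset α → Finset α → α → α → R)
    {A : Matrix {P : Finset α × Finset α // P.1.card = P.2.card}
      {P : Finset α × Finset α // P.1.card = P.2.card} R}
    (hA : ∀ P Q, A P Q = ∑ i, ∑ j,
      if i ∉ P.1.1 ∧ j ∉ P.1.2 ∧ Q.1 = (insert i P.1.1, insert j P.1.2)
      then w P.1.1 P.1.2 i j else 0)
    (n : ℕ) (P Q : {P : Finset α × Finset α // P.1.card = P.2.card}) :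
    (A ^ n) P Q = ∑ g : Fin n → α, ∑ h : Fin n → α,
      if (Function.Injective g ∧ (∀ t, g t ∉ P.1.1) ∧ P.1.1 ∪ univ.image g = Q.1.1) ∧
          (Function.Injective h ∧ (∀ t, h t ∉ P.1.2) ∧ P.1.2 ∪ univ.image h = Q.1.2)
      then ∏ t : Fin n, w (P.1.1 ∪ (univ.filter fun i : Fin n => (i : ℕ) < (t : ℕ)).image g)
        (P.1.2 ∪ (univ.filter fun i : Fin n => (i : ℕ) < (t : ℕ)).image h) (g t) (h t)
      else 0 := by
  induction n generalizing P with
  | zero =>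
    have : (P.1.1 = Q.1.1 ∧ P.1.2 = Q.1.2) ↔ P = Q := by
      rw [Subtype.ext_iff, Prod.ext_iff]
    simp [Matrix.one_apply, Function.injective_of_subsingleton, this]
  | succ n ih =>
    rw [pow_succ', Matrix.mul_apply]
    calc ∑ U, A P U * (A ^ n) U Q
        = ∑ U, ∑ i, ∑ j, (if i ∉ P.1.1 ∧ j ∉ P.1.2 ∧ U.1 = (insert i P.1.1, insert j P.1.2)
            then w P.1.1 P.1.2 i j * (A ^ n) U Q else 0) := by
          refine sum_congr rfl fun U _ => ?_
          rw [hA, sum_mul]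
          refine sum_congr rfl fun i _ => ?_
          rw [sum_mul]
          refine sum_congr rfl fun j _ => ?_
          split_ifs <;> simp
      _ = ∑ i, ∑ j, ∑ U : {P : Finset α × Finset α // P.1.card = P.2.card},
            (if i ∉ P.1.1 ∧ j ∉ P.1.2 ∧ U.1 = (insert i P.1.1, insert j P.1.2)
            then w P.1.1 P.1.2 i j * (A ^ n) U Q else 0) := by
          rw [sum_comm]
          exact sum_congr rfl fun i _ => sum_comm
      _ = ∑ i, ∑ j, (if i ∉ P.1.1 ∧ j ∉ P.1.2 then
            w P.1.1 P.1.2 i j * ∑ g : Fin n → α, ∑ h : Fin n → α,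
              (if (Function.Injective g ∧ (∀ t, g t ∉ insert i P.1.1) ∧
                    insert i P.1.1 ∪ univ.image g = Q.1.1) ∧
                  (Function.Injective h ∧ (∀ t, h t ∉ insert j P.1.2) ∧
                    insert j P.1.2 ∪ univ.image h = Q.1.2)
                then ∏ t : Fin n, w (insert i P.1.1 ∪ (univ.filter fun s : Fin n => (s : ℕ) < (t : ℕ)).image g)
                  (insert j P.1.2 ∪ (univ.filter fun s : Fin n => (s : ℕ) < (t : ℕ)).image h) (g t) (h t)
                else 0) else 0) := by
          refine sum_congr rfl fun i _ => sum_congr rfl fun j _ => ?_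
          by_cases hij : i ∉ P.1.1 ∧ j ∉ P.1.2
          · rw [if_pos hij]
            have hbal : (insert i P.1.1, insert j P.1.2).1.card = (insert i P.1.1, insert j P.1.2).2.card := by
              simp only [card_insert_of_notMem hij.1, card_insert_of_notMem hij.2, P.2]
            rw [Finset.sum_eq_single_of_mem (⟨(insert i P.1.1, insert j P.1.2), hbal⟩ :
                {P : Finset α × Finset α // P.1.card = P.2.card})
              (mem_univ _) (fun U _ hU => if_neg fun h => hU (Subtype.ext h.2.2)),
              if_pos ⟨hij.1, hij.2, rfl⟩, ih]
          · rw [if_neg hij]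
            exact sum_eq_zero fun U _ => if_neg fun h => hij ⟨h.1, h.2.1⟩
      _ = ∑ i, ∑ j, ∑ g : Fin n → α, ∑ h : Fin n → α,
            (if (i ∉ P.1.1 ∧ (Function.Injective g ∧ (∀ t, g t ∉ insert i P.1.1) ∧
                    insert i P.1.1 ∪ univ.image g = Q.1.1)) ∧
                (j ∉ P.1.2 ∧ (Function.Injective h ∧ (∀ t, h t ∉ insert j P.1.2) ∧
                    insert j P.1.2 ∪ univ.image h = Q.1.2))
              then w P.1.1 P.1.2 i j *
                ∏ t : Fin n, w (insert i P.1.1 ∪ (univ.filter fun s : Fin n => (s : ℕ) < (t : ℕ)).image g)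
                  (insert j P.1.2 ∪ (univ.filter fun s : Fin n => (s : ℕ) < (t : ℕ)).image h) (g t) (h t)
              else 0) := by
          refine sum_congr rfl fun i _ => sum_congr rfl fun j _ => ?_
          by_cases hij : i ∉ P.1.1 ∧ j ∉ P.1.2
          · rw [if_pos hij, mul_sum]
            refine sum_congr rfl fun g _ => ?_
            rw [mul_sum]
            refine sum_congr rfl fun h _ => ?_
            by_cases hc : (Function.Injective g ∧ (∀ t, g t ∉ insert i P.1.1) ∧
                    insert i P.1.1 ∪ univ.image g = Q.1.1) ∧
                  (Function.Injective h ∧ (∀ t, h t ∉ insert j P.1.2) ∧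
                    insert j P.1.2 ∪ univ.image h = Q.1.2)
            · rw [if_pos hc, if_pos ⟨⟨hij.1, hc.1⟩, ⟨hij.2, hc.2⟩⟩]
            · rw [if_neg hc, mul_zero, if_neg fun H => hc ⟨H.1.2, H.2.2⟩]
          · rw [if_neg hij]
            symm
            refine sum_eq_zero fun g _ => sum_eq_zero fun h _ => if_neg fun H => hij ⟨H.1.1, H.2.1⟩
      _ = ∑ i, ∑ g : Fin n → α, ∑ j, ∑ h : Fin n → α,
            (if (i ∉ P.1.1 ∧ (Function.Injective g ∧ (∀ t, g t ∉ insert i P.1.1) ∧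
                    insert i P.1.1 ∪ univ.image g = Q.1.1)) ∧
                (j ∉ P.1.2 ∧ (Function.Injective h ∧ (∀ t, h t ∉ insert j P.1.2) ∧
                    insert j P.1.2 ∪ univ.image h = Q.1.2))
              then w P.1.1 P.1.2 i j *
                ∏ t : Fin n, w (insert i P.1.1 ∪ (univ.filter fun s : Fin n => (s : ℕ) < (t : ℕ)).image g)
                  (insert j P.1.2 ∪ (univ.filter fun s : Fin n => (s : ℕ) < (t : ℕ)).image h) (g t) (h t)
              else 0) := by
          exact sum_congr rfl fun i _ => sum_comm
      _ = _ := by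
          rw [sum_cons]
          refine sum_congr rfl fun i _ => sum_congr rfl fun g _ => ?_
          rw [sum_cons]
          refine sum_congr rfl fun j _ => sum_congr rfl fun h _ => ?_
          have hiff := and_congr (cons_cond_iff P.1.1 Q.1.1 i g) (cons_cond_iff P.1.2 Q.1.2 j h)
          by_cases hc : (i ∉ P.1.1 ∧ (Function.Injective g ∧ (∀ t, g t ∉ insert i P.1.1) ∧
                    insert i P.1.1 ∪ univ.image g = Q.1.1)) ∧
                (j ∉ P.1.2 ∧ (Function.Injective h ∧ (∀ t, h t ∉ insert j P.1.2) ∧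
                    insert j P.1.2 ∪ univ.image h = Q.1.2))
          · rw [if_pos hc, if_pos (hiff.mpr hc), Fin.prod_univ_succ, Fin.cons_zero, Fin.cons_zero,
              union_prefix_cons_zero, union_prefix_cons_zero]
            congr 1
            refine prod_congr rfl fun t _ => ?_
            rw [Fin.cons_succ, Fin.cons_succ, union_prefix_cons_succ, union_prefix_cons_succ]
          · rw [if_neg hc, if_neg fun H => hc (hiff.mp H)]

/-- An arc raises the common cardinality, so `1 - A` is block upper-unitriangular for the grading
`(I, J) ↦ |I|` and `det (1 - A) = 1` (the pairs branching program of Props. 2.10 / 2.17, with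
node-dependent arc weights). [cite: LandsbergRessayre2017, Prop. 2.17] -/
theorem pairArc_det_one_sub (w : Finset α → Finset α → α → α → R)
    {A : Matrix {P : Finset α × Finset α // P.1.card = P.2.card}
      {P : Finset α × Finset α // P.1.card = P.2.card} R}
    (hA : ∀ P Q, A P Q = ∑ i, ∑ j,
      if i ∉ P.1.1 ∧ j ∉ P.1.2 ∧ Q.1 = (insert i P.1.1, insert j P.1.2)
      then w P.1.1 P.1.2 i j else 0) :
    (1 - A).det = 1 := by
  have hAPQ : ∀ P Q : {P : Finset α × Finset α // P.1.card = P.2.card},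
      Q.1.1.card ≤ P.1.1.card → A P Q = 0 := by
    intro P Q hle
    rw [hA]
    refine sum_eq_zero fun i _ => sum_eq_zero fun j _ => if_neg ?_
    rintro ⟨hi, -, hQ⟩
    have : Q.1.1 = insert i P.1.1 := by rw [hQ]
    rw [this, card_insert_of_notMem hi] at hle
    omega
  have hT : (1 - A).BlockTriangular
      fun P : {P : Finset α × Finset α // P.1.card = P.2.card} => P.1.1.card := by
    intro P Q hlt
    have hne : P ≠ Q := by
      rintro rfl
      exact lt_irrefl _ hlt
    rw [Matrix.sub_apply, Matrix.one_apply_ne hne, hAPQ P Q hlt.le, sub_zero]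
  rw [hT.det]
  refine prod_eq_one fun c _ => ?_
  rw [show (1 - A).toSquareBlock
    (fun P : {P : Finset α × Finset α // P.1.card = P.2.card} => P.1.1.card) c = 1 from ?_,
    Matrix.det_one]
  ext ⟨P, hP⟩ ⟨Q, hQ⟩
  rw [Matrix.toSquareBlock_def, Matrix.of_apply, Matrix.sub_apply, hAPQ P Q (by rw [hP, hQ]),
    sub_zero, Matrix.one_apply, Matrix.one_apply]
  simp only [Subtype.mk.injEq]

variable {m : ℕ}

/-- For `α = Fin m` every path of the pairs program has length `≤ m`: `A ^ (m + 1) = 0`.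
[cite: LandsbergRessayre2017, Prop. 2.17] -/
theorem pairArc_pow_succ_eq_zero (w : Finset (Fin m) → Finset (Fin m) → Fin m → Fin m → R)
    {A : Matrix {P : Finset (Fin m) × Finset (Fin m) // P.1.card = P.2.card}
      {P : Finset (Fin m) × Finset (Fin m) // P.1.card = P.2.card} R}
    (hA : ∀ P Q, A P Q = ∑ i, ∑ j,
      if i ∉ P.1.1 ∧ j ∉ P.1.2 ∧ Q.1 = (insert i P.1.1, insert j P.1.2)
      then w P.1.1 P.1.2 i j else 0) :
    A ^ (m + 1) = 0 := by
  ext P Q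
  rw [pairArc_pow_apply w hA, Matrix.zero_apply]
  refine sum_eq_zero fun g _ => sum_eq_zero fun h _ => if_neg ?_
  rintro ⟨⟨hg, -, -⟩, -⟩
  simpa using Fintype.card_le_of_injective g hg

/-- The adjugate of the unipotent `1 - A` of the pairs program is the finite geometric series
`∑_{i ≤ m} Aⁱ` ("each term in an expansion contains `n - m` elements of `Λ₀`", p0013:L80–L81: the
cofactors of `Ã` are path sums). [cite: LandsbergRessayre2017, Prop. 2.17] -/
theorem pairArc_adjugate_one_sub (w : Finset (Fin m) → Finset (Fin m) → Fin m → Fin m → R)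
    {A : Matrix {P : Finset (Fin m) × Finset (Fin m) // P.1.card = P.2.card}
      {P : Finset (Fin m) × Finset (Fin m) // P.1.card = P.2.card} R}
    (hA : ∀ P Q, A P Q = ∑ i, ∑ j,
      if i ∉ P.1.1 ∧ j ∉ P.1.2 ∧ Q.1 = (insert i P.1.1, insert j P.1.2)
      then w P.1.1 P.1.2 i j else 0) :
    (1 - A).adjugate = ∑ i ∈ range (m + 1), A ^ i := by
  have hmul : (1 - A) * ∑ i ∈ range (m + 1), A ^ i = 1 := by
    rw [mul_neg_geom_sum, pairArc_pow_succ_eq_zero w hA, sub_zero]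
  have hinv := Matrix.inv_eq_right_inv hmul
  rwa [Matrix.inv_def, pairArc_det_one_sub w hA, Ring.inverse_one, one_smul] at hinv

/-- **The `(src, snk)` cofactor of `1 - A` is the full path sum**: the sum over the pairs `(g, h)`
of injective maps `Fin m → Fin m` of `∏ₜ w (g({i<t})) (h({i<t})) (g t) (h t)`.
[cite: LandsbergRessayre2017, Prop. 2.17] -/
theorem pairArc_adjugate_one_sub_src_snk (w : Finset (Fin m) → Finset (Fin m) → Fin m → Fin m → R)
    {A : Matrix {P : Finset (Fin m) × Finset (Fin m) // P.1.card = P.2.card}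
      {P : Finset (Fin m) × Finset (Fin m) // P.1.card = P.2.card} R}
    (hA : ∀ P Q, A P Q = ∑ i, ∑ j,
      if i ∉ P.1.1 ∧ j ∉ P.1.2 ∧ Q.1 = (insert i P.1.1, insert j P.1.2)
      then w P.1.1 P.1.2 i j else 0) :
    (1 - A).adjugate ⟨(∅, ∅), rfl⟩ ⟨(univ, univ), rfl⟩ =
      ∑ g : Fin m → Fin m, ∑ h : Fin m → Fin m,
        if Function.Injective g ∧ Function.Injective h then
          ∏ t : Fin m, w ((univ.filter fun i : Fin m => (i : ℕ) < (t : ℕ)).image g)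
            ((univ.filter fun i : Fin m => (i : ℕ) < (t : ℕ)).image h) (g t) (h t)
        else 0 := by
  have himg : ∀ {n : ℕ} (g : Fin n → Fin m), Function.Injective g →
      (univ.image g = univ ↔ n = m) := by
    intro n g hg
    constructor
    · intro h
      have hc := card_image_of_injective univ hg
      rw [h, card_univ, card_univ, Fintype.card_fin, Fintype.card_fin] at hc
      exact hc.symm
    · intro h
      apply eq_univ_of_card
      rw [card_image_of_injective univ hg, card_univ, Fintype.card_fin, h, Fintype.card_fin]
  rw [pairArc_adjugate_one_sub w hA, Matrix.sum_apply, sum_eq_single_of_mem m (by simp) ?_]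
  · rw [pairArc_pow_apply w hA]
    refine sum_congr rfl fun g _ => sum_congr rfl fun h _ => ?_
    simp only [Finset.notMem_empty, not_false_eq_true, implies_true, true_and, empty_union]
    by_cases hg : Function.Injective g
    · by_cases hh : Function.Injective h
      · simp [hg, hh, (himg g hg).2 rfl, (himg h hh).2 rfl]
      · simp [hh]
    · simp [hg]
  · intro i _ hi
    rw [pairArc_pow_apply w hA]
    refine sum_eq_zero fun g _ => sum_eq_zero fun h _ => if_neg ?_
    rintro ⟨⟨hg, -, hT⟩, -⟩
    simp only [empty_union] at hT
    exact hi ((himg g hg).1 hT)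

/-- **Signed double sum over permutations.**
`∑_{σ, τ} sign σ sign τ ∏ₜ M (σ t) (τ t) = m! · ∑_ρ sign ρ ∏ₛ M (ρ s) s`: for fixed `τ` reindex
the product by `s = τ t` and the sum by `ρ = σ τ⁻¹` (`sign ρ = sign σ sign τ`) — the signed form of
"Grenet's representation for `perm_m (y…y)` which is `m!(y¹₁⋯yᵐₘ)`" (p0013:L75–L80: each permutation
arises from `m!` pairs of orderings). [cite: LandsbergRessayre2017, Prop. 2.17] -/
theorem sum_perm_perm_sign_prod (M : Fin m → Fin m → R) :
    ∑ σ : Equiv.Perm (Fin m), ∑ τ : Equiv.Perm (Fin m),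
        ((Equiv.Perm.sign σ : ℤ) : R) * ((Equiv.Perm.sign τ : ℤ) : R) * ∏ t, M (σ t) (τ t) =
      (m.factorial : R) * ∑ ρ : Equiv.Perm (Fin m), ((Equiv.Perm.sign ρ : ℤ) : R) * ∏ s, M (ρ s) s := by
  classical
  have key : ∀ τ : Equiv.Perm (Fin m),
      ∑ σ : Equiv.Perm (Fin m), ((Equiv.Perm.sign σ : ℤ) : R) * ((Equiv.Perm.sign τ : ℤ) : R) *
          ∏ t, M (σ t) (τ t) =
        ∑ ρ : Equiv.Perm (Fin m), ((Equiv.Perm.sign ρ : ℤ) : R) * ∏ s, M (ρ s) s := by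
    intro τ
    have hprod : ∀ σ : Equiv.Perm (Fin m), ∏ t, M (σ t) (τ t) = ∏ s, M ((σ * τ⁻¹) s) s := by
      intro σ
      rw [← Equiv.prod_comp τ (fun s => M ((σ * τ⁻¹) s) s)]
      refine prod_congr rfl fun t _ => ?_
      simp [Equiv.Perm.mul_apply]
    have hsign : ∀ σ : Equiv.Perm (Fin m),
        ((Equiv.Perm.sign σ : ℤ) : R) * ((Equiv.Perm.sign τ : ℤ) : R) =
          ((Equiv.Perm.sign (σ * τ⁻¹) : ℤ) : R) := by
      intro σ
      rw [Equiv.Perm.sign_mul, Equiv.Perm.sign_inv, Units.val_mul, Int.cast_mul]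
    simp_rw [hprod, hsign]
    exact Fintype.sum_equiv (Equiv.mulRight τ⁻¹) _ _ fun σ => rfl
  rw [sum_comm]
  simp_rw [key]
  rw [sum_const, card_univ, Fintype.card_perm, Fintype.card_fin, nsmul_eq_mul]

end PairsPaths

/-! ### The determinant of Prop. 2.17's matrix -/

section DetAux

variable {R : Type*} [CommRing R] {m : ℕ}

/-- Double sums over injective maps are double sums over permutations. [folklore] -/
private theorem sum_sum_ite_injective (F : (Fin m → Fin m) → (Fin m → Fin m) → R) :
    (∑ g : Fin m → Fin m, ∑ h : Fin m → Fin m,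
        if Function.Injective g ∧ Function.Injective h then F g h else 0) =
      ∑ σ : Equiv.Perm (Fin m), ∑ τ : Equiv.Perm (Fin m), F σ τ := by
  have step : ∀ g : Fin m → Fin m, (∑ h : Fin m → Fin m,
      if Function.Injective g ∧ Function.Injective h then F g h else 0) =
      if Function.Injective g then
        ∑ h : Fin m → Fin m, (if Function.Injective h then F g h else 0) else 0 := by
    intro g
    split_ifs with hg
    · refine sum_congr rfl fun h _ => ?_
      by_cases hh : Function.Injective h
      · rw [if_pos ⟨hg, hh⟩, if_pos hh]
      · rw [if_neg (fun H => hh H.2), if_neg hh]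
    · exact sum_eq_zero fun h _ => if_neg fun H => hg H.1
  simp_rw [step]
  rw [Grenet.sum_ite_injective]
  exact sum_congr rfl fun σ _ => Grenet.sum_ite_injective _

/-- `∏_{t < m} (if t = 0 then 1 else x) = x ^ (m - 1)` (`m ≥ 1`). [folklore] -/
private theorem prod_ite_val_eq_zero (hm : 1 ≤ m) (x : R) :
    (∏ t : Fin m, if (t : ℕ) = 0 then (1 : R) else x) = x ^ (m - 1) := by
  obtain ⟨m', rfl⟩ : ∃ m', m = m' + 1 := ⟨m - 1, by omega⟩
  rw [Fin.prod_univ_succ, Fin.val_zero, if_pos rfl, one_mul, Nat.add_sub_cancel]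
  simp only [Fin.val_succ, Nat.succ_ne_zero, if_false, prod_const, card_univ, Fintype.card_fin]

/-- The prefix set `σ({i < t})` is empty iff `t = 0`. [folklore] -/
private theorem prefix_image_eq_empty_iff (σ : Equiv.Perm (Fin m)) (t : Fin m) :
    (univ.filter fun i : Fin m => (i : ℕ) < (t : ℕ)).image σ = ∅ ↔ (t : ℕ) = 0 := by
  rw [← Finset.card_eq_zero, Grenet.card_prefix_image σ (le_of_lt t.2)]

/-- `(∏_t (-1)^t)² = 1`. [folklore] -/
private theorem prod_neg_one_pow_mul_self :
    (∏ t : Fin m, (-1 : ℤ) ^ (t : ℕ)) * (∏ t : Fin m, (-1 : ℤ) ^ (t : ℕ)) = 1 := by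
  rw [← Finset.prod_mul_distrib]
  refine Finset.prod_eq_one fun t _ => ?_
  rw [← pow_add, ← two_mul, pow_mul, neg_one_sq, one_pow]

/-- `m ≤ C(2m,m) - 1 = |FullIdx m|`: the diagonal nodes `({i<t}, {i<t})`, `t < m`, are distinct.
[folklore] -/
private theorem le_choose_sub_one (m : ℕ) : m ≤ (2 * m).choose m - 1 := by
  classical
  rw [← card_fullIdx]
  have hne : ∀ t : Fin m, (univ.filter fun i : Fin m => (i : ℕ) < (t : ℕ)) ≠ univ := by
    intro t h
    have hc := congrArg Finset.card h
    rw [Fin.card_filter_val_lt, card_univ, Fintype.card_fin, min_eq_right (le_of_lt t.2)] at hc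
    exact absurd hc (ne_of_lt t.2)
  let f : Fin m → FullIdx m := fun t =>
    ⟨(univ.filter fun i : Fin m => (i : ℕ) < (t : ℕ), univ.filter fun i : Fin m => (i : ℕ) < (t : ℕ)),
      rfl, hne t⟩
  have hf : Function.Injective f := by
    intro t t' h
    have h1 : (univ.filter fun i : Fin m => (i : ℕ) < (t : ℕ)).card =
        (univ.filter fun i : Fin m => (i : ℕ) < (t' : ℕ)).card := by
      have := congrArg (fun p : FullIdx m => p.1.1) h
      exact congrArg Finset.card this
    rw [Fin.card_filter_val_lt, Fin.card_filter_val_lt, min_eq_right (le_of_lt t.2),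
      min_eq_right (le_of_lt t'.2)] at h1
    exact Fin.ext h1
  have := Fintype.card_le_of_injective f hf
  rwa [Fintype.card_fin] at this

end DetAux

section Det

variable (k : Type*) [Field k] (m : ℕ)

/-- The generic determinant as a signed permutation sum with `C`-coefficients. [folklore] -/
private theorem detPoly_fin_eq_sum_C :
    detPoly (Fin m) k =
      ∑ σ : Equiv.Perm (Fin m), C ((Equiv.Perm.sign σ : ℤ) : k) * ∏ i, X (σ i, i) := by
  rw [detPoly, Matrix.det_apply]
  refine Finset.sum_congr rfl fun σ _ => ?_
  rw [Units.smul_def, ← Int.cast_smul_eq_zsmul k, MvPolynomial.smul_eq_C_mul]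
  rfl

/-- **`det Ã = (-1)^{m+1} c^{n-m} m! · det_m` for Prop. 2.17's matrix with scalar `c ≠ 0` on `Λ₀`**
(`n = C(2m,m) - 1`; p0013:L72–L81: "specialize to the diagonal matrices … this upper-left corner is
exactly Grenet's representation for `perm_m (y)` which is `m!(y¹₁⋯yᵐₘ)`. Finally note that each term
in an expansion contains `n - m` elements of `Λ₀`"), over any field, `m ≥ 1`. Proof (the expansion made
explicit): after scaling the rows of `Ãᵀ` at levels `≥ 1` by `c⁻¹`, `Ãᵀ` is the `(≠ snk)`-block of the
unipotent `1 - A` of the balanced-pairs program — arcs `(S,R) → (S∪i, R∪j)` of weight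
`-c^{-[S≠∅]} ε(S,i) ε(R,j) x_{ij}` — with its row `snk` replaced by the unit row at `src` and its
columns `src`, `snk` swapped; hence `c^{-(n-1)} det Ã = -adj(1 - A)_{src,snk}`, minus the full path sum
(`pairArc_adjugate_one_sub_src_snk`): over the pairs of orderings `(σ, τ)` of
`(-1)^m c^{-(m-1)} (∏ₜ ε(σ{<t},σ t)) (∏ₜ ε(τ{<t},τ t)) ∏ₜ x_{σ t, τ t}`, the Koszul signs multiplying to
`sign σ sign τ` (`prod_koszulSign_prefix`), and `Σ_{σ,τ} sign σ sign τ ∏ₜ x_{σt,τt} = m! det_m`.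
[cite: LandsbergRessayre2017, Prop. 2.17] -/
theorem det_detFullMatrix (hm : 1 ≤ m) {c : k} (hc : c ≠ 0) :
    (detFullMatrix k m c).det =
      C ((-1) ^ (m + 1) * c ^ ((2 * m).choose m - 1 - m) * (m.factorial : k)) * detPoly (Fin m) k := by
  classical
  -- the source and the sink of the balanced-pairs program
  set src : {P : Finset (Fin m) × Finset (Fin m) // P.1.card = P.2.card} := ⟨(∅, ∅), rfl⟩ with hsrc
  set snk : {P : Finset (Fin m) × Finset (Fin m) // P.1.card = P.2.card} := ⟨(univ, univ), rfl⟩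
    with hsnk
  have hne0 : (∅ : Finset (Fin m)) ≠ univ := by
    haveI : Nonempty (Fin m) := ⟨⟨0, hm⟩⟩
    exact Finset.univ_nonempty.ne_empty.symm
  have hne : src ≠ snk := fun h => hne0 (congrArg (fun P => P.1.1) h)
  -- balanced pairs: the second component is empty / full iff the first is
  have hbal0 : ∀ P : {P : Finset (Fin m) × Finset (Fin m) // P.1.card = P.2.card},
      P.1.2 = ∅ ↔ P.1.1 = ∅ := fun P => by
    rw [← Finset.card_eq_zero, ← P.2, Finset.card_eq_zero]
  have hbalu : ∀ P : {P : Finset (Fin m) × Finset (Fin m) // P.1.card = P.2.card},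
      P.1.2 = univ ↔ P.1.1 = univ := fun P => by
    rw [← Finset.card_eq_iff_eq_univ, ← P.2, Finset.card_eq_iff_eq_univ]
  have hsrc_iff : ∀ P : {P : Finset (Fin m) × Finset (Fin m) // P.1.card = P.2.card},
      P = src ↔ P.1.1 = ∅ := fun P => by
    constructor
    · rintro rfl; rfl
    · intro h
      exact Subtype.ext (Prod.ext h ((hbal0 P).2 h))
  have hsnk_iff : ∀ P : {P : Finset (Fin m) × Finset (Fin m) // P.1.card = P.2.card},
      P = snk ↔ P.1.1 = univ := fun P => by
    constructor
    · rintro rfl; rfl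
    · intro h
      exact Subtype.ext (Prod.ext h ((hbalu P).2 h))
  -- the scaled signed arc weights and the adjacency matrix of the balanced-pairs program
  set sc : Finset (Fin m) → MvPolynomial (Fin m × Fin m) k :=
    fun S => if S = ∅ then 1 else C c⁻¹ with hsc
  set w : Finset (Fin m) → Finset (Fin m) → Fin m → Fin m → MvPolynomial (Fin m × Fin m) k :=
    fun S T i j => -(sc S * (C ((koszulSign S i * koszulSign T j : ℤ) : k) * X (i, j))) with hw
  set A : Matrix {P : Finset (Fin m) × Finset (Fin m) // P.1.card = P.2.card}
      {P : Finset (Fin m) × Finset (Fin m) // P.1.card = P.2.card} (MvPolynomial (Fin m × Fin m) k) :=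
    Matrix.of fun P Q => ∑ i, ∑ j,
      if i ∉ P.1.1 ∧ j ∉ P.1.2 ∧ Q.1 = (insert i P.1.1, insert j P.1.2)
      then w P.1.1 P.1.2 i j else 0 with hAdef
  have hA : ∀ P Q, A P Q = ∑ i, ∑ j,
      if i ∉ P.1.1 ∧ j ∉ P.1.2 ∧ Q.1 = (insert i P.1.1, insert j P.1.2)
      then w P.1.1 P.1.2 i j else 0 := fun _ _ => rfl
  set D : Matrix {P : Finset (Fin m) × Finset (Fin m) // P.1.card = P.2.card}
      {P : Finset (Fin m) × Finset (Fin m) // P.1.card = P.2.card} (MvPolynomial (Fin m × Fin m) k) :=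
    (1 - A).updateRow snk (Pi.single src 1) with hD
  set D' : Matrix {P : Finset (Fin m) × Finset (Fin m) // P.1.card = P.2.card}
      {P : Finset (Fin m) × Finset (Fin m) // P.1.card = P.2.card} (MvPolynomial (Fin m × Fin m) k) :=
    D.submatrix id (Equiv.swap src snk) with hD'
  -- the row scaling of `Ãᵀ` and the transport `FullIdx m ≃ {P // P.1.1 ≠ univ}`
  set dF : FullIdx m → MvPolynomial (Fin m × Fin m) k := fun S => sc S.1.1 with hdF
  let ef : FullIdx m ≃ {P : {P : Finset (Fin m) × Finset (Fin m) // P.1.card = P.2.card} //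
      P.1.1 ≠ univ} :=
    { toFun := fun p => ⟨⟨p.1, p.2.1⟩, p.2.2⟩
      invFun := fun q => ⟨q.1.1, q.1.2, q.2⟩
      left_inv := fun p => rfl
      right_inv := fun q => rfl }
  -- `diag(dF) Ãᵀ` is the `(≠ snk)`-block of `D'`
  have hblock : Matrix.reindex ef ef (Matrix.diagonal dF * (detFullMatrix k m c)ᵀ) =
      D'.toSquareBlockProp fun P => P.1.1 ≠ univ := by
    refine Matrix.ext fun S' T' => ?_
    have hS'ne : S'.1 ≠ snk := fun h => S'.2 ((hsnk_iff _).1 h)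
    have hT'ne : T'.1 ≠ snk := fun h => T'.2 ((hsnk_iff _).1 h)
    rw [Matrix.reindex_apply, Matrix.submatrix_apply, Matrix.diagonal_mul, Matrix.transpose_apply,
      Matrix.toSquareBlockProp_def, Matrix.of_apply, hD', Matrix.submatrix_apply, id, hD,
      Matrix.updateRow_ne hS'ne]
    change sc S'.1.1.1 * detFullMatrix k m c ⟨T'.1.1, T'.1.2, T'.2⟩ ⟨S'.1.1, S'.1.2, S'.2⟩ = _
    rw [detFullMatrix, Matrix.of_apply]
    by_cases hT : T'.1 = src
    · -- the column of the source: the wrap arcs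
      have hT1 : T'.1.1.1 = ∅ := (hsrc_iff _).1 hT
      have hT2 : T'.1.1.2 = ∅ := (hbal0 _).2 hT1
      have hsw : Equiv.swap src snk T'.1 = snk := by rw [hT, Equiv.swap_apply_left]
      rw [hsw, Matrix.sub_apply, Matrix.one_apply_ne hS'ne, zero_sub, hA,
        show snk.1 = (univ, univ) from rfl]
      have h1 : ¬((⟨T'.1.1, T'.1.2, T'.2⟩ : FullIdx m) = ⟨S'.1.1, S'.1.2, S'.2⟩ ∧ S'.1.1.1.Nonempty) := by
        rintro ⟨h, hS⟩
        have h' : T'.1.1.1 = S'.1.1.1 := congrArg (fun p : FullIdx m => p.1.1) h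
        rw [← h', hT1] at hS
        exact Finset.not_nonempty_empty hS
      rw [if_neg h1, zero_add, Finset.mul_sum, ← Finset.sum_neg_distrib]
      refine Finset.sum_congr rfl fun i _ => ?_
      rw [Finset.mul_sum, ← Finset.sum_neg_distrib]
      refine Finset.sum_congr rfl fun j _ => ?_
      have hw1 : ∀ Z : Finset (Fin m), Z ≠ ∅ → (∅ = wrap m Z ↔ univ = Z) := by
        intro Z hZ
        unfold wrap
        split_ifs with h
        · exact ⟨fun _ => h.symm, fun _ => rfl⟩
        · exact ⟨fun h' => absurd h'.symm hZ, fun h' => absurd h'.symm h⟩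
      have hwi := hw1 (insert i S'.1.1.1) (Finset.insert_ne_empty i _)
      have hwj := hw1 (insert j S'.1.1.2) (Finset.insert_ne_empty j _)
      simp only [hT1, hT2, hwi, hwj, Prod.mk.injEq]
      split_ifs with h
      · rw [hw, neg_neg]
      · rw [mul_zero, neg_zero]
    · -- a column at level `≥ 1`
      have hT1 : T'.1.1.1 ≠ ∅ := fun h => hT ((hsrc_iff _).2 h)
      have hT2 : T'.1.1.2 ≠ ∅ := fun h => hT1 ((hbal0 _).1 h)
      have hT2u : T'.1.1.2 ≠ univ := fun h => T'.2 ((hbalu _).1 h)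
      rw [Equiv.swap_apply_of_ne_of_ne hT hT'ne, Matrix.sub_apply, hA, Matrix.one_apply, mul_add,
        sub_eq_add_neg]
      congr 1
      · by_cases hST : S'.1 = T'.1
        · have hST' : S' = T' := Subtype.ext hST
          subst hST'
          have hS0 : S'.1.1.1.Nonempty := Finset.nonempty_iff_ne_empty.2 hT1
          rw [if_pos ⟨rfl, hS0⟩, if_pos rfl, hsc]
          dsimp only
          rw [if_neg hT1, ← map_mul, inv_mul_cancel₀ hc, map_one]
        · rw [if_neg hST, if_neg, mul_zero]
          rintro ⟨h, -⟩
          exact hST (congrArg Subtype.val (ef.symm.injective h)).symm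
      · rw [Finset.mul_sum, ← Finset.sum_neg_distrib]
        refine Finset.sum_congr rfl fun i _ => ?_
        rw [Finset.mul_sum, ← Finset.sum_neg_distrib]
        refine Finset.sum_congr rfl fun j _ => ?_
        have hw2 : ∀ (T Z : Finset (Fin m)), T ≠ ∅ → T ≠ univ → (T = wrap m Z ↔ T = Z) := by
          intro T Z hT0 hTu
          unfold wrap
          split_ifs with h
          · exact ⟨fun h' => absurd h' hT0, fun h' => absurd (h'.trans h) hTu⟩
          · exact Iff.rfl
        simp only [hw2 _ _ hT1 T'.2, hw2 _ _ hT2 hT2u, Prod.ext_iff]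
        split_ifs with h
        · rw [hw, neg_neg]
        · rw [mul_zero, neg_zero]
  -- `D'` is block lower triangular with corner entry `1`
  have htri : ∀ P, ¬(P.1.1 ≠ univ) → ∀ Q, Q.1.1 ≠ univ → D' P Q = 0 := by
    intro P hP Q hQ
    rw [not_ne_iff] at hP
    have hP' : P = snk := (hsnk_iff _).2 hP
    subst hP'
    have hsw : Equiv.swap src snk Q ≠ src := by
      intro h
      rw [Equiv.swap_apply_eq_iff, Equiv.swap_apply_left] at h
      exact hQ ((hsnk_iff _).1 h)
    rw [hD', Matrix.submatrix_apply, id, hD, Matrix.updateRow_self]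
    exact Pi.single_eq_of_ne hsw _
  have hcorner : (D'.toSquareBlockProp fun P => ¬(P.1.1 ≠ univ)).det = 1 := by
    have hcard : Fintype.card {P : {P : Finset (Fin m) × Finset (Fin m) // P.1.card = P.2.card} //
        ¬(P.1.1 ≠ univ)} = 1 := by
      rw [Fintype.card_subtype, Finset.card_eq_one]
      refine ⟨snk, Finset.ext fun P => ?_⟩
      rw [Finset.mem_filter, Finset.mem_singleton, not_ne_iff, ← hsnk_iff]
      simp
    rw [Matrix.det_eq_elem_of_card_eq_one hcard ⟨snk, fun h => h rfl⟩,
      Matrix.toSquareBlockProp_def, Matrix.of_apply, hD', Matrix.submatrix_apply, id, hD,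
      Matrix.updateRow_self, Equiv.swap_apply_right, Pi.single_eq_same]
  have hdetD' : D'.det = (Matrix.diagonal dF * (detFullMatrix k m c)ᵀ).det := by
    rw [Matrix.twoBlockTriangular_det D' (fun P => P.1.1 ≠ univ) htri, hcorner, mul_one, ← hblock,
      Matrix.det_reindex_self]
  -- hence `det (diag(dF) Ãᵀ) = -adj(1 - A)_{src,snk}` = minus the full signed path sum
  have hdet : (Matrix.diagonal dF * (detFullMatrix k m c)ᵀ).det =
      -∑ σ : Equiv.Perm (Fin m), ∑ τ : Equiv.Perm (Fin m),
        ∏ t : Fin m, w ((univ.filter fun i : Fin m => (i : ℕ) < (t : ℕ)).image σ)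
          ((univ.filter fun i : Fin m => (i : ℕ) < (t : ℕ)).image τ) (σ t) (τ t) := by
    rw [← hdetD', hD', Matrix.det_permute', Equiv.Perm.sign_swap hne, hD, ← Matrix.adjugate_apply,
      pairArc_adjugate_one_sub_src_snk w hA, sum_sum_ite_injective]
    simp
  -- the path products
  have hpath : ∀ σ τ : Equiv.Perm (Fin m),
      (∏ t : Fin m, w ((univ.filter fun i : Fin m => (i : ℕ) < (t : ℕ)).image σ)
          ((univ.filter fun i : Fin m => (i : ℕ) < (t : ℕ)).image τ) (σ t) (τ t)) =
        C ((-1) ^ m * c⁻¹ ^ (m - 1)) *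
          (((Equiv.Perm.sign σ : ℤ) : MvPolynomial (Fin m × Fin m) k) *
            ((Equiv.Perm.sign τ : ℤ) : MvPolynomial (Fin m × Fin m) k) * ∏ t : Fin m, X (σ t, τ t)) := by
    intro σ τ
    have hwt : ∀ t : Fin m, w ((univ.filter fun i : Fin m => (i : ℕ) < (t : ℕ)).image σ)
          ((univ.filter fun i : Fin m => (i : ℕ) < (t : ℕ)).image τ) (σ t) (τ t) =
        (-1) * ((if (t : ℕ) = 0 then (1 : MvPolynomial (Fin m × Fin m) k) else C c⁻¹) *
          (C ((koszulSign ((univ.filter fun i : Fin m => (i : ℕ) < (t : ℕ)).image σ) (σ t) *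
              koszulSign ((univ.filter fun i : Fin m => (i : ℕ) < (t : ℕ)).image τ) (τ t) : ℤ) : k) *
            X (σ t, τ t))) := by
      intro t
      have hsct : sc ((univ.filter fun i : Fin m => (i : ℕ) < (t : ℕ)).image σ) =
          if (t : ℕ) = 0 then 1 else C c⁻¹ := by
        rw [hsc]
        dsimp only
        by_cases ht : (t : ℕ) = 0
        · rw [if_pos ((prefix_image_eq_empty_iff σ t).2 ht), if_pos ht]
        · rw [if_neg (fun h => ht ((prefix_image_eq_empty_iff σ t).1 h)), if_neg ht]
      rw [hw]
      dsimp only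
      rw [hsct, neg_one_mul]
    simp_rw [hwt]
    rw [Finset.prod_mul_distrib, Finset.prod_const, Finset.card_univ, Fintype.card_fin,
      Finset.prod_mul_distrib, prod_ite_val_eq_zero hm, Finset.prod_mul_distrib, ← map_prod C,
      ← Int.cast_prod, Finset.prod_mul_distrib, prod_koszulSign_prefix, prod_koszulSign_prefix,
      mul_mul_mul_comm, prod_neg_one_pow_mul_self, one_mul]
    simp only [map_mul, map_pow, map_neg, map_one, map_intCast, Int.cast_mul]
    ring
  -- the full path sum is `(-1)^m c^{-(m-1)} m! det_m`
  have hsum : (∑ σ : Equiv.Perm (Fin m), ∑ τ : Equiv.Perm (Fin m),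
        ∏ t : Fin m, w ((univ.filter fun i : Fin m => (i : ℕ) < (t : ℕ)).image σ)
          ((univ.filter fun i : Fin m => (i : ℕ) < (t : ℕ)).image τ) (σ t) (τ t)) =
      C ((-1) ^ m * c⁻¹ ^ (m - 1) * (m.factorial : k)) * detPoly (Fin m) k := by
    simp_rw [hpath]
    simp_rw [← Finset.mul_sum]
    rw [sum_perm_perm_sign_prod (R := MvPolynomial (Fin m × Fin m) k) (fun i j => X (i, j)),
      detPoly_fin_eq_sum_C]
    simp only [map_mul, map_natCast, map_intCast, map_pow, map_neg, map_one]
    ring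
  -- `det (diag(dF) Ãᵀ) = c^{-(n-1)} det Ã`
  have hprodF : (∏ S : FullIdx m, dF S) = C c⁻¹ ^ ((2 * m).choose m - 1 - 1) := by
    set srcF : FullIdx m := ⟨(∅, ∅), rfl, hne0⟩ with hsrcF
    rw [← card_fullIdx, ← Finset.prod_erase_mul _ _ (Finset.mem_univ srcF)]
    have h1 : dF srcF = 1 := if_pos rfl
    rw [h1, mul_one, Finset.prod_congr rfl (fun S hS => ?_), Finset.prod_const,
      Finset.card_erase_of_mem (Finset.mem_univ _), Finset.card_univ]
    rw [Finset.mem_erase] at hS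
    have hS0 : S.1.1 ≠ ∅ := by
      intro h
      refine hS.1 (Subtype.ext (Prod.ext h ?_))
      rw [← Finset.card_eq_zero, ← S.2.1, h, Finset.card_empty]
    exact if_neg hS0
  have hL : (Matrix.diagonal dF * (detFullMatrix k m c)ᵀ).det =
      C (c⁻¹ ^ ((2 * m).choose m - 1 - 1)) * (detFullMatrix k m c).det := by
    rw [Matrix.det_mul, Matrix.det_diagonal, hprodF, Matrix.det_transpose, map_pow]
  -- conclusion
  have hnm : m ≤ (2 * m).choose m - 1 := le_choose_sub_one m
  have he : (2 * m).choose m - 1 - 1 = ((2 * m).choose m - 1 - m) + (m - 1) := by omega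
  have key : C (c⁻¹ ^ ((2 * m).choose m - 1 - 1)) * (detFullMatrix k m c).det =
      -(C ((-1) ^ m * c⁻¹ ^ (m - 1) * (m.factorial : k)) * detPoly (Fin m) k) := by
    rw [← hL, hdet, hsum]
  have hcc : C (c ^ ((2 * m).choose m - 1 - 1)) * C (c⁻¹ ^ ((2 * m).choose m - 1 - 1)) =
      (1 : MvPolynomial (Fin m × Fin m) k) := by
    rw [← map_mul, ← mul_pow, mul_inv_cancel₀ hc, one_pow, map_one]
  have hcm : (C c : MvPolynomial (Fin m × Fin m) k) ^ (m - 1) * (C c⁻¹) ^ (m - 1) = 1 := by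
    rw [← mul_pow, ← map_mul, mul_inv_cancel₀ hc, map_one, one_pow]
  calc (detFullMatrix k m c).det
      = C (c ^ ((2 * m).choose m - 1 - 1)) * (C (c⁻¹ ^ ((2 * m).choose m - 1 - 1)) *
          (detFullMatrix k m c).det) := by rw [← mul_assoc, hcc, one_mul]
    _ = C (c ^ ((2 * m).choose m - 1 - 1)) *
          -(C ((-1) ^ m * c⁻¹ ^ (m - 1) * (m.factorial : k)) * detPoly (Fin m) k) := by rw [key]
    _ = _ := by
        rw [he, pow_succ]
        simp only [map_mul, map_pow, map_neg, map_one, map_natCast, pow_add]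
        linear_combination (-((-1) ^ m * (C c : MvPolynomial (Fin m × Fin m) k) ^
          ((2 * m).choose m - 1 - m) * (m.factorial : MvPolynomial (Fin m × Fin m) k) *
            detPoly (Fin m) k)) * hcm

end Det

/-! ### Regularity: affine entries and `rank Ã(0) = n - 1` -/

section Regular

variable (k : Type*) [Field k] (m : ℕ)

/-- The entries of Prop. 2.17's matrix are affine linear. [cite: LandsbergRessayre2017, Prop. 2.17] -/
theorem totalDegree_detFullMatrix_le (c : k) (T S : FullIdx m) :
    (detFullMatrix k m c T S).totalDegree ≤ 1 := by
  rw [detFullMatrix, Matrix.of_apply]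
  refine (totalDegree_add _ _).trans (max_le ?_ ?_)
  · split_ifs
    · exact (totalDegree_C _).le.trans zero_le_one
    · simp
  · refine totalDegree_finsetSum_le fun i _ => totalDegree_finsetSum_le fun j _ => ?_
    split_ifs
    · refine (totalDegree_mul _ _).trans ?_
      rw [totalDegree_C, zero_add]
      exact (totalDegree_X _).le
    · simp

/-- The constant part of Prop. 2.17's matrix is `c Λ₀ = diag(0, c, …, c)` (zero exactly at the
merged vertex `(∅, ∅)`). [cite: LandsbergRessayre2017, Prop. 2.17] -/
theorem constPart_detFullMatrix (c : k) :
    constPart (detFullMatrix k m c) =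
      Matrix.diagonal fun S : FullIdx m => if S.1.1.Nonempty then c else 0 := by
  classical
  refine Matrix.ext fun T S => ?_
  rw [constPart_apply, detFullMatrix, Matrix.of_apply, map_add, map_sum, Matrix.diagonal_apply]
  have hsum : (∑ i : Fin m, constantCoeff (∑ j : Fin m,
      if i ∉ S.1.1 ∧ j ∉ S.1.2 ∧ T.1.1 = wrap m (insert i S.1.1) ∧ T.1.2 = wrap m (insert j S.1.2)
      then C ((koszulSign S.1.1 i * koszulSign S.1.2 j : ℤ) : k) * X (i, j) else 0)) = 0 := by
    refine Finset.sum_eq_zero fun i _ => ?_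
    rw [map_sum]
    refine Finset.sum_eq_zero fun j _ => ?_
    split_ifs
    · rw [map_mul, constantCoeff_X, mul_zero]
    · exact constantCoeff.map_zero
  rw [hsum, add_zero]
  by_cases hTS : T = S
  · subst hTS
    simp only [true_and, if_true]
    split_ifs
    · exact constantCoeff_C _ _
    · exact constantCoeff.map_zero
  · rw [if_neg hTS, if_neg fun h => hTS h.1, constantCoeff.map_zero]

variable {m} in
/-- `rank (c Λ₀) = n - 1` for `c ≠ 0` (`m ≥ 1`), transported along `e`.
[cite: LandsbergRessayre2017, Prop. 2.17] -/
theorem rank_constPart_reindex_detFullMatrix (hm : 1 ≤ m) {c : k} (hc : c ≠ 0) {n : ℕ}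
    (e : FullIdx m ≃ Fin n) :
    (constPart (Matrix.reindex e e (detFullMatrix k m c))).rank = n - 1 := by
  classical
  have hne : (∅ : Finset (Fin m)) ≠ univ := by
    haveI : Nonempty (Fin m) := ⟨⟨0, hm⟩⟩
    exact Finset.univ_nonempty.ne_empty.symm
  set srcF : FullIdx m := ⟨(∅, ∅), rfl, hne⟩ with hsrcF
  have hc' : constPart (Matrix.reindex e e (detFullMatrix k m c)) =
      Matrix.reindex e e
        (Matrix.diagonal fun S : FullIdx m => if S.1.1.Nonempty then c else 0) := by
    rw [← constPart_detFullMatrix]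
    rfl
  rw [hc', Matrix.rank_reindex, Matrix.rank_diagonal, Fintype.card_subtype]
  have hfilter : (univ.filter fun S : FullIdx m => (if S.1.1.Nonempty then c else 0) ≠ 0) =
      univ.erase srcF := by
    ext S
    simp only [Finset.mem_filter, Finset.mem_univ, true_and, Finset.mem_erase, and_true, ne_eq,
      ite_eq_right_iff, hc, imp_false, not_not, Finset.nonempty_iff_ne_empty]
    refine not_congr ⟨fun h => Subtype.ext (Prod.ext h ?_), fun h => by rw [h]⟩
    rw [← Finset.card_eq_zero, ← S.2.1, h, Finset.card_empty]
  rw [hfilter, Finset.card_erase_of_mem (Finset.mem_univ _), Finset.card_univ, Fintype.card_congr e,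
    Fintype.card_fin]

variable {m} in
/-- **Prop. 2.17, first half: `Ã` is a REGULAR determinantal representation of
`(-1)^{m+1} c^{n-m} m! · det_m`** (size `n = C(2m,m) - 1`, any bijection `e`, any `c ≠ 0`): affine
entries, the determinant, and `rank Ã(0) = rank (c Λ₀) = n - 1`. [cite: LandsbergRessayre2017, Prop. 2.17] -/
theorem isRegularDetRepr_detFullMatrix (hm : 1 ≤ m) {c : k} (hc : c ≠ 0) {n : ℕ}
    (e : FullIdx m ≃ Fin n) :
    IsRegularDetRepr
      (C ((-1) ^ (m + 1) * c ^ ((2 * m).choose m - 1 - m) * (m.factorial : k)) * detPoly (Fin m) k)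
      (Matrix.reindex e e (detFullMatrix k m c)) := by
  refine ⟨⟨fun i j => ?_, ?_⟩, rank_constPart_reindex_detFullMatrix k hm hc e⟩
  · rw [Matrix.reindex_apply, Matrix.submatrix_apply]
    exact totalDegree_detFullMatrix_le k m c _ _
  · rw [Matrix.det_reindex_self, det_detFullMatrix k m hm hc]

end Regular

/-! ### Increasing enumerations of finite sets of indices (as in the Prop. 2.16 companion) -/

section Enumeration

variable {m : ℕ}

/-- The `a`-th element (in increasing order) of `U` has exactly `a` elements of `U` below it.
[folklore] -/
private theorem card_filter_lt_orderEmbOfFin {U : Finset (Fin m)} {r : ℕ} (hU : U.card = r)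
    (a : Fin r) : (U.filter (· < U.orderEmbOfFin hU a)).card = a := by
  have key : U.filter (· < U.orderEmbOfFin hU a) = (Finset.Iio a).image (U.orderEmbOfFin hU) := by
    ext x
    simp only [Finset.mem_filter, Finset.mem_image, Finset.mem_Iio]
    constructor
    · rintro ⟨hx, hlt⟩
      have hx' : x ∈ Set.range (U.orderEmbOfFin hU) := by
        rw [Finset.range_orderEmbOfFin]
        exact hx
      obtain ⟨b, rfl⟩ := hx'
      exact ⟨b, (U.orderEmbOfFin hU).lt_iff_lt.mp hlt, rfl⟩
    · rintro ⟨b, hb, rfl⟩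
      exact ⟨Finset.orderEmbOfFin_mem U hU b, (U.orderEmbOfFin hU).lt_iff_lt.mpr hb⟩
  rw [key, Finset.card_image_of_injective _ (U.orderEmbOfFin hU).injective, Fin.card_Iio]

/-- Deleting the `a`-th element: the increasing enumeration of `U` composed with `a.succAbove` is
the increasing enumeration of `U ∖ {a-th element}`. [folklore] -/
private theorem orderEmbOfFin_comp_succAbove {U S' : Finset (Fin m)} {r : ℕ} (hU : U.card = r + 1)
    (hS' : S'.card = r) (a : Fin (r + 1))
    (hmem : ∀ x, x ∈ S' ↔ x ∈ U ∧ x ≠ U.orderEmbOfFin hU a) :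
    (fun x => U.orderEmbOfFin hU (a.succAbove x)) = S'.orderEmbOfFin hS' := by
  refine Finset.orderEmbOfFin_unique hS' (fun x => ?_) ?_
  · rw [hmem]
    exact ⟨Finset.orderEmbOfFin_mem U hU _,
      fun h => Fin.succAbove_ne a x ((U.orderEmbOfFin hU).injective h)⟩
  · exact (U.orderEmbOfFin hU).strictMono.comp (Fin.strictMono_succAbove a)

end Enumeration

/-! ### Minors: Laplace expansion against a Koszul-signed column, Cauchy–Binet -/

section Minors

variable {m : ℕ} {R : Type*} [CommRing R]

/-- Reading a minor `det G_{X,Y}` through any pair of cardinality proofs. [folklore] -/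
private theorem minor_eq {G : Matrix (Fin m) (Fin m) R} {M : Matrix (Finset (Fin m)) (Finset (Fin m)) R}
    (hM : ∀ X Y, M X Y = if h : X.card = Y.card then
      (G.submatrix (X.orderEmbOfFin rfl) (Y.orderEmbOfFin h.symm)).det else 0)
    {X Y : Finset (Fin m)} {r : ℕ} (hX : X.card = r) (hY : Y.card = r) :
    M X Y = (G.submatrix (X.orderEmbOfFin hX) (Y.orderEmbOfFin hY)).det := by
  rw [hM, dif_pos (hX.trans hY.symm)]
  subst hX
  rfl

/-- **Laplace expansion of the minors against one column, with Koszul signs**: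
`Σ_{i ∈ U} ε(U∖i, i) G_{ij} det G_{U∖i, S} = ε(S, j) det G_{U, S ∪ j}` if `j ∉ S`, and `= 0` if
`j ∈ S`. [folklore] -/
private theorem sum_koszulSign_mul_minor_erase {G : Matrix (Fin m) (Fin m) R}
    {M : Matrix (Finset (Fin m)) (Finset (Fin m)) R}
    (hM : ∀ X Y, M X Y = if h : X.card = Y.card then
      (G.submatrix (X.orderEmbOfFin rfl) (Y.orderEmbOfFin h.symm)).det else 0)
    (U S : Finset (Fin m)) (j : Fin m) :
    (∑ i ∈ U, (koszulSign (U.erase i) i : R) * G i j * M (U.erase i) S) =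
      if j ∉ S then (koszulSign S j : R) * M U (insert j S) else 0 := by
  classical
  by_cases hcard : U.card = S.card + 1
  swap
  · have h1 : ∀ i ∈ U, M (U.erase i) S = 0 := fun i hi => by
      have hpos : 0 < U.card := Finset.card_pos.mpr ⟨i, hi⟩
      have hne : (U.erase i).card ≠ S.card := by
        rw [Finset.card_erase_of_mem hi]
        omega
      rw [hM, dif_neg hne]
    rw [Finset.sum_eq_zero fun i hi => by rw [h1 i hi, mul_zero]]
    split_ifs with hj
    · rfl
    · have hne : U.card ≠ (insert j S).card := by
        rw [Finset.card_insert_of_notMem hj]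
        exact hcard
      rw [hM, dif_neg hne, mul_zero]
  set r := S.card with hr
  have hsum : (∑ i ∈ U, (koszulSign (U.erase i) i : R) * G i j * M (U.erase i) S) =
      ∑ a : Fin (r + 1), (-1 : R) ^ (a : ℕ) * G (U.orderEmbOfFin hcard a) j *
        (G.submatrix (fun x => U.orderEmbOfFin hcard (a.succAbove x)) (S.orderEmbOfFin rfl)).det := by
    have hmap := Finset.sum_map Finset.univ (U.orderEmbOfFin hcard).toEmbedding
      (fun i => (koszulSign (U.erase i) i : R) * G i j * M (U.erase i) S)
    rw [Finset.map_orderEmbOfFin_univ] at hmap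
    rw [hmap]
    refine Finset.sum_congr rfl fun a _ => ?_
    have hi := Finset.orderEmbOfFin_mem U hcard a
    have hUe : (U.erase (U.orderEmbOfFin hcard a)).card = r := by
      rw [Finset.card_erase_of_mem hi, hcard, Nat.add_sub_cancel]
    rw [RelEmbedding.coe_toEmbedding, minor_eq hM hUe rfl,
      ← orderEmbOfFin_comp_succAbove hcard hUe a (fun x => Finset.mem_erase.trans
        ⟨fun h => ⟨h.2, h.1⟩, fun h => ⟨h.2, h.1⟩⟩)]
    congr 2
    unfold koszulSign
    rw [Finset.filter_erase, Finset.erase_eq_of_notMem (by simp),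
      card_filter_lt_orderEmbOfFin hcard a]
    push_cast
    rfl
  rw [hsum]
  by_cases hj : j ∈ S
  · rw [if_neg (not_not.mpr hj)]
    obtain ⟨b₀, hb₀⟩ : j ∈ Set.range (S.orderEmbOfFin rfl) := by
      rw [Finset.range_orderEmbOfFin]
      exact hj
    set N' : Matrix (Fin (r + 1)) (Fin (r + 1)) R :=
      G.submatrix (U.orderEmbOfFin hcard) (Fin.cons j (S.orderEmbOfFin rfl)) with hN'
    have hdet : N'.det = 0 := by
      refine Matrix.det_zero_of_column_eq (Fin.succ_ne_zero b₀).symm fun a => ?_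
      simp only [hN', Matrix.submatrix_apply, Fin.cons_zero, Fin.cons_succ, hb₀]
    rw [Matrix.det_succ_column N' 0] at hdet
    rw [← hdet]
    refine Finset.sum_congr rfl fun a _ => ?_
    simp only [hN', Matrix.submatrix_apply, Matrix.submatrix_submatrix, Fin.cons_zero,
      Fin.val_zero, add_zero, Fin.succAbove_zero]
    rfl
  · rw [if_pos hj]
    have hSj : (insert j S).card = r + 1 := by rw [Finset.card_insert_of_notMem hj]
    rw [minor_eq hM hcard hSj]
    obtain ⟨p, hp⟩ : j ∈ Set.range ((insert j S).orderEmbOfFin hSj) := by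
      rw [Finset.range_orderEmbOfFin]
      exact Finset.mem_insert_self j S
    have hpS : (fun x => (insert j S).orderEmbOfFin hSj (p.succAbove x)) = S.orderEmbOfFin rfl :=
      orderEmbOfFin_comp_succAbove hSj rfl p fun x => by
        rw [hp, Finset.mem_insert]
        constructor
        · intro hx
          exact ⟨Or.inr hx, fun h => hj (h ▸ hx)⟩
        · rintro ⟨hx | hx, hne⟩
          · exact absurd hx hne
          · exact hx
    have hκ : (koszulSign S j : R) = (-1) ^ (p : ℕ) := by
      unfold koszulSign
      rw [← card_filter_lt_orderEmbOfFin hSj p, hp, Finset.filter_insert, if_neg (lt_irrefl j)]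
      push_cast
      rfl
    rw [hκ, Matrix.det_succ_column _ p, Finset.mul_sum]
    refine Finset.sum_congr rfl fun a _ => ?_
    simp only [Matrix.submatrix_apply, Matrix.submatrix_submatrix, hp]
    have hp2 : ((-1 : R) ^ (p : ℕ)) * (-1) ^ (p : ℕ) = 1 := by
      rw [← pow_add, ← two_mul, pow_mul, neg_one_sq, one_pow]
    rw [show (fun x => ((insert j S).orderEmbOfFin hSj) (p.succAbove x)) =
        ⇑((insert j S).orderEmbOfFin hSj) ∘ p.succAbove from rfl] at hpS
    rw [hpS, pow_add]
    simp only [Function.comp_def]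
    linear_combination (-((-1 : R) ^ (a : ℕ) * G (U.orderEmbOfFin hcard a) j *
      (G.submatrix (fun x => U.orderEmbOfFin hcard (a.succAbove x)) ⇑(S.orderEmbOfFin rfl)).det)) *
      hp2

/-- **The wedge intertwining** `ex(Gv) ∘ Λ(G) = Λ(G) ∘ ex(v)`: for the Koszul-signed wedge matrix
`W(v)_{U,S} = ε(S,i) v_i` (`U = S ∪ {i}`) and the block-diagonal matrix of minors
`M_{X,Y} = det G_{X,Y}`, `W(Gv) M = M W(v)`. [folklore] -/
private theorem wedge_mul_minor {G : Matrix (Fin m) (Fin m) R}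
    {M : Matrix (Finset (Fin m)) (Finset (Fin m)) R}
    (hM : ∀ X Y, M X Y = if h : X.card = Y.card then
      (G.submatrix (X.orderEmbOfFin rfl) (Y.orderEmbOfFin h.symm)).det else 0)
    (v : Fin m → R) {W Wg : Matrix (Finset (Fin m)) (Finset (Fin m)) R}
    (hW : ∀ U S, W U S = ∑ i, if i ∉ S ∧ U = insert i S then (koszulSign S i : R) * v i else 0)
    (hWg : ∀ U S, Wg U S =
      ∑ i, if i ∉ S ∧ U = insert i S then (koszulSign S i : R) * G.mulVec v i else 0) :
    Wg * M = M * W := by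
  classical
  ext U S
  rw [Matrix.mul_apply, Matrix.mul_apply]
  have hcollapse : ∀ (f : Finset (Fin m) → Fin m → R) (i : Fin m),
      (∑ S', (if i ∉ S' ∧ U = insert i S' then f S' i else 0) * M S' S) =
        if i ∈ U then f (U.erase i) i * M (U.erase i) S else 0 := by
    intro f i
    rw [Finset.sum_eq_single (U.erase i)]
    · by_cases hi : i ∈ U
      · rw [if_pos ⟨Finset.notMem_erase i U, (Finset.insert_erase hi).symm⟩, if_pos hi]
      · rw [if_neg, if_neg hi, zero_mul]
        rintro ⟨-, h⟩
        exact hi (h ▸ Finset.mem_insert_self i _)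
    · intro S' _ hS'
      rw [if_neg, zero_mul]
      rintro ⟨hi, rfl⟩
      exact hS' (Finset.erase_insert hi).symm
    · intro h
      exact absurd (Finset.mem_univ _) h
  have hL : (∑ S', Wg U S' * M S' S) =
      ∑ j, (∑ i ∈ U, (koszulSign (U.erase i) i : R) * G i j * M (U.erase i) S) * v j := by
    simp_rw [hWg, Finset.sum_mul]
    rw [Finset.sum_comm]
    simp_rw [hcollapse (fun S' i => (koszulSign S' i : R) * G.mulVec v i), ← Finset.sum_filter,
      Finset.filter_mem_eq_inter, Finset.univ_inter, Matrix.mulVec, dotProduct, Finset.mul_sum,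
      Finset.sum_mul]
    rw [Finset.sum_comm]
    refine Finset.sum_congr rfl fun j _ => Finset.sum_congr rfl fun i _ => ?_
    ring
  have hR : (∑ T', M U T' * W T' S) =
      ∑ j, (if j ∉ S then (koszulSign S j : R) * M U (insert j S) else 0) * v j := by
    simp_rw [hW, Finset.mul_sum]
    rw [Finset.sum_comm]
    refine Finset.sum_congr rfl fun j _ => ?_
    rw [Finset.sum_eq_single (insert j S)]
    · by_cases hj : j ∈ S
      · simp [hj]
      · simp [hj]
        ring
    · intro T' _ hT'
      rw [if_neg, mul_zero]
      rintro ⟨-, rfl⟩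
      exact hT' rfl
    · intro h
      exact absurd (Finset.mem_univ _) h
  rw [hL, hR]
  refine Finset.sum_congr rfl fun j _ => ?_
  rw [sum_koszulSign_mul_minor_erase hM U S j]

/-- **Cauchy–Binet for the block matrix of minors**: `M(G) M(H) = M(GH)` (the tree's
`compound_mul`, block by block). [cite: Bernstein2009, Fact 7.5.17] -/
private theorem minor_mul_minor {G H : Matrix (Fin m) (Fin m) R}
    {MG MH MGH : Matrix (Finset (Fin m)) (Finset (Fin m)) R}
    (hMG : ∀ X Y, MG X Y = if h : X.card = Y.card then
      (G.submatrix (X.orderEmbOfFin rfl) (Y.orderEmbOfFin h.symm)).det else 0)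
    (hMH : ∀ X Y, MH X Y = if h : X.card = Y.card then
      (H.submatrix (X.orderEmbOfFin rfl) (Y.orderEmbOfFin h.symm)).det else 0)
    (hMGH : ∀ X Y, MGH X Y = if h : X.card = Y.card then
      ((G * H).submatrix (X.orderEmbOfFin rfl) (Y.orderEmbOfFin h.symm)).det else 0) :
    MG * MH = MGH := by
  classical
  ext X Z
  rw [Matrix.mul_apply]
  by_cases hXZ : X.card = Z.card
  swap
  · rw [hMGH, dif_neg hXZ]
    refine Finset.sum_eq_zero fun Y _ => ?_
    by_cases hXY : X.card = Y.card
    · rw [hMH, dif_neg (fun h => hXZ (hXY.trans h)), mul_zero]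
    · rw [hMG, dif_neg hXY, zero_mul]
  set r := X.card with hr
  have hcomp : ∀ (A : Matrix (Fin m) (Fin m) R) {X' Y' : Finset (Fin m)} (hX' : X'.card = r)
      (hY' : Y'.card = r),
      (A.submatrix (X'.orderEmbOfFin hX') (Y'.orderEmbOfFin hY')).det =
        Literature.LinearAlgebra.Matrix.compound r A (Set.powersetCard.ofCard hX')
          (Set.powersetCard.ofCard hY') := fun A X' Y' hX' hY' => rfl
  have hsum : (∑ Y, MG X Y * MH Y Z) =
      ∑ Y : Set.powersetCard (Fin m) r,
        Literature.LinearAlgebra.Matrix.compound r G (Set.powersetCard.ofCard rfl) Y *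
          Literature.LinearAlgebra.Matrix.compound r H Y (Set.powersetCard.ofCard hXZ.symm) := by
    have hterm : ∀ Y : Finset (Fin m), MG X Y * MH Y Z =
        if hY : Y.card = r then
          Literature.LinearAlgebra.Matrix.compound r G (Set.powersetCard.ofCard rfl)
              (Set.powersetCard.ofCard hY) *
            Literature.LinearAlgebra.Matrix.compound r H (Set.powersetCard.ofCard hY)
              (Set.powersetCard.ofCard hXZ.symm) else 0 := by
      intro Y
      by_cases hY : Y.card = r
      · rw [dif_pos hY, minor_eq hMG rfl hY, minor_eq hMH hY hXZ.symm, hcomp, hcomp]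
      · rw [dif_neg hY, hMG, dif_neg (fun h => hY h.symm), zero_mul]
    simp_rw [hterm]
    rw [← Finset.sum_filter_of_ne (s := Finset.univ) (p := fun Y : Finset (Fin m) => Y.card = r)
        (fun Y _ hY => by
          by_contra h
          exact hY (dif_neg h)),
      Finset.sum_subtype (univ.filter fun Y : Finset (Fin m) => Y.card = r)
        (p := fun Y : Finset (Fin m) => Y ∈ Set.powersetCard (Fin m) r)
        (fun Y => by simp [Set.powersetCard.mem_iff])]
    refine Finset.sum_congr rfl fun Y _ => ?_
    rw [dif_pos (Set.powersetCard.mem_iff.mp Y.2)]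
    rfl
  rw [hsum, ← Matrix.mul_apply, ← Literature.LinearAlgebra.Matrix.compound_mul, hMGH, dif_pos hXZ]
  rfl

/-- Off-level minors vanish. [folklore] -/
private theorem minor_of_card_ne {G : Matrix (Fin m) (Fin m) R}
    {M : Matrix (Finset (Fin m)) (Finset (Fin m)) R}
    (hM : ∀ X Y, M X Y = if h : X.card = Y.card then
      (G.submatrix (X.orderEmbOfFin rfl) (Y.orderEmbOfFin h.symm)).det else 0)
    {X Y : Finset (Fin m)} (h : X.card ≠ Y.card) : M X Y = 0 := by
  rw [hM, dif_neg h]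

/-- The empty minor is `1`. [folklore] -/
private theorem minor_empty_empty {G : Matrix (Fin m) (Fin m) R}
    {M : Matrix (Finset (Fin m)) (Finset (Fin m)) R}
    (hM : ∀ X Y, M X Y = if h : X.card = Y.card then
      (G.submatrix (X.orderEmbOfFin rfl) (Y.orderEmbOfFin h.symm)).det else 0) :
    M ∅ ∅ = 1 := by
  rw [minor_eq hM (Finset.card_empty) (Finset.card_empty)]
  exact Matrix.det_fin_zero

/-- The full minor is `det G`. [folklore] -/
private theorem minor_univ_univ {G : Matrix (Fin m) (Fin m) R}
    {M : Matrix (Finset (Fin m)) (Finset (Fin m)) R}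
    (hM : ∀ X Y, M X Y = if h : X.card = Y.card then
      (G.submatrix (X.orderEmbOfFin rfl) (Y.orderEmbOfFin h.symm)).det else 0) :
    M univ univ = G.det := by
  rw [minor_eq hM (Finset.card_fin m) (Finset.card_fin m)]
  have hid : (fun x => x) = ⇑((univ : Finset (Fin m)).orderEmbOfFin (Finset.card_fin m)) :=
    Finset.orderEmbOfFin_unique _ (fun x => Finset.mem_univ _) strictMono_id
  rw [← hid]
  exact congrArg Matrix.det (Matrix.submatrix_id_id G)

/-- The identity matrix of the subset lattice in the "matrix of minors" normal form. [folklore] -/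
private theorem one_eq_minor_one {K : Type*} [Field K] (X Y : Finset (Fin m)) :
    (1 : Matrix (Finset (Fin m)) (Finset (Fin m)) K) X Y = if h : X.card = Y.card then
      ((1 : Matrix (Fin m) (Fin m) K).submatrix (X.orderEmbOfFin rfl) (Y.orderEmbOfFin h.symm)).det
      else 0 := by
  classical
  by_cases h : X.card = Y.card
  · rw [dif_pos h]
    change _ = Literature.LinearAlgebra.Matrix.compound X.card (1 : Matrix (Fin m) (Fin m) K)
      (Set.powersetCard.ofCard rfl) (Set.powersetCard.ofCard h.symm)
    rw [Literature.LinearAlgebra.Matrix.compound_one, Matrix.one_apply, Matrix.one_apply]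
    simp only [Set.powersetCard.ofCard, Subtype.mk.injEq]
  · rw [dif_neg h, Matrix.one_apply, if_neg]
    rintro rfl
    exact h rfl

/-- Block extraction for a product whose second factor has a vanishing lower-left block.
[folklore] -/
private theorem toSquareBlockProp_mul_of_lowerLeft {ι : Type*} [Fintype ι]
    (p : ι → Prop) [DecidablePred p] (A B : Matrix ι ι R) (h : B.toBlock (fun i => ¬p i) p = 0) :
    (A * B).toSquareBlockProp p = A.toSquareBlockProp p * B.toSquareBlockProp p := by
  change (A * B).toBlock p p = A.toBlock p p * B.toBlock p p
  rw [Matrix.toBlock_mul_eq_add p p p A B, h, Matrix.mul_zero, add_zero]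

end Minors

/-! ### The product lattice of pairs of subsets: arcs `⊗` minors, the wrap row, block extraction -/

section PairLattice

variable {m : ℕ} {R : Type*} [CommRing R]

/-- The arc entries of the pairs lattice factor through the one-sided wedge matrices: with the arc
`(S₁,S₂) → (S₁ ∪ i, S₂ ∪ j)` carrying `ε(S₁,i) ε(S₂,j) v i j`,
`N_{X,Y} = Σ_j [Y.2 = X.2 ∪ j] ε(Y.2… ) …` — precisely the rearrangement used twice below. [folklore] -/
private theorem pairArc_factor (v : Fin m → Fin m → R) (X Y : Finset (Fin m) × Finset (Fin m)) :
    (∑ i, ∑ j, if i ∉ Y.1 ∧ j ∉ Y.2 ∧ X = (insert i Y.1, insert j Y.2) then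
        (koszulSign Y.1 i : R) * (koszulSign Y.2 j : R) * v i j else 0) =
      ∑ j, if j ∉ Y.2 ∧ X.2 = insert j Y.2 then (koszulSign Y.2 j : R) *
        (∑ i, if i ∉ Y.1 ∧ X.1 = insert i Y.1 then (koszulSign Y.1 i : R) * v i j else 0) else 0 := by
  rw [Finset.sum_comm]
  refine Finset.sum_congr rfl fun j _ => ?_
  split_ifs with hj
  · rw [Finset.mul_sum]
    refine Finset.sum_congr rfl fun i _ => ?_
    by_cases hi : i ∉ Y.1 ∧ X.1 = insert i Y.1
    · rw [if_pos hi, if_pos ⟨hi.1, hj.1, Prod.ext hi.2 hj.2⟩]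
      ring
    · rw [if_neg hi, if_neg, mul_zero]
      rintro ⟨h1, -, h3⟩
      exact hi ⟨h1, (Prod.ext_iff.1 h3).1⟩
  · refine Finset.sum_eq_zero fun i _ => if_neg ?_
    rintro ⟨-, h2, h3⟩
    exact hj ⟨h2, (Prod.ext_iff.1 h3).2⟩

/-- **Step 1 (pairs).** For the arc matrix `N(x)` of the lattice of PAIRS of subsets (arc
`(S₁,S₂) → (S₁∪i, S₂∪j)` carrying `ε(S₁,i) ε(S₂,j) x_{ij}`), its version `N(Gx)` with the
columns `x_{•j}` multiplied by `G`, and `𝕄 = M(G) ⊗ 1` (minors of `G` in the first factor):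
`N(Gx) 𝕄 = 𝕄 N(x)` — the wedge intertwining in the first tensor factor. [folklore] -/
private theorem pairArcs_mul_minor {G : Matrix (Fin m) (Fin m) R}
    {M : Matrix (Finset (Fin m)) (Finset (Fin m)) R}
    (hM : ∀ X Y, M X Y = if h : X.card = Y.card then
      (G.submatrix (X.orderEmbOfFin rfl) (Y.orderEmbOfFin h.symm)).det else 0)
    (f : Fin m → Fin m → R)
    {MM N Ng : Matrix (Finset (Fin m) × Finset (Fin m)) (Finset (Fin m) × Finset (Fin m)) R}
    (hMM : ∀ P Q, MM P Q = M P.1 Q.1 * if P.2 = Q.2 then 1 else 0)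
    (hN : ∀ X Y, N X Y = ∑ i, ∑ j, if i ∉ Y.1 ∧ j ∉ Y.2 ∧ X = (insert i Y.1, insert j Y.2) then
      (koszulSign Y.1 i : R) * (koszulSign Y.2 j : R) * f i j else 0)
    (hNg : ∀ X Y, Ng X Y = ∑ i, ∑ j, if i ∉ Y.1 ∧ j ∉ Y.2 ∧ X = (insert i Y.1, insert j Y.2) then
      (koszulSign Y.1 i : R) * (koszulSign Y.2 j : R) * G.mulVec (fun l => f l j) i else 0) :
    Ng * MM = MM * N := by
  classical
  ext P Q
  obtain ⟨T, U⟩ := P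
  obtain ⟨S, V⟩ := Q
  -- the one-sided wedge matrices for the column `j`
  set W : Fin m → Matrix (Finset (Fin m)) (Finset (Fin m)) R := fun j => Matrix.of fun U' S' =>
    ∑ i, if i ∉ S' ∧ U' = insert i S' then (koszulSign S' i : R) * f i j else 0 with hWdef
  set Wg : Fin m → Matrix (Finset (Fin m)) (Finset (Fin m)) R := fun j => Matrix.of fun U' S' =>
    ∑ i, if i ∉ S' ∧ U' = insert i S' then (koszulSign S' i : R) * G.mulVec (fun l => f l j) i else 0
    with hWgdef
  have key : ∀ j, Wg j * M = M * W j := fun j =>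
    wedge_mul_minor hM (fun l => f l j) (W := W j) (Wg := Wg j) (fun _ _ => rfl) (fun _ _ => rfl)
  rw [Matrix.mul_apply, Matrix.mul_apply]
  have hL : (∑ X, Ng (T, U) X * MM X (S, V)) = ∑ X, Ng (T, U) (X, V) * M X S := by
    rw [Fintype.sum_prod_type]
    refine Finset.sum_congr rfl fun X _ => ?_
    simp_rw [hMM]
    simp only [mul_ite, mul_one, mul_zero, Finset.sum_ite_eq', Finset.mem_univ, if_true]
  have hR : (∑ X, MM (T, U) X * N X (S, V)) = ∑ X, M T X * N (X, U) (S, V) := by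
    rw [Fintype.sum_prod_type]
    refine Finset.sum_congr rfl fun X _ => ?_
    simp_rw [hMM]
    simp only [ite_mul, zero_mul, mul_ite, mul_zero, mul_one, Finset.sum_ite_eq, Finset.mem_univ,
      if_true]
  rw [hL, hR]
  have hNg' : ∀ X, Ng (T, U) (X, V) = ∑ j, if j ∉ V ∧ U = insert j V then
      (koszulSign V j : R) * Wg j T X else 0 := by
    intro X
    rw [hNg, pairArc_factor]
    rfl
  have hN' : ∀ X, N (X, U) (S, V) = ∑ j, if j ∉ V ∧ U = insert j V then
      (koszulSign V j : R) * W j X S else 0 := by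
    intro X
    rw [hN, pairArc_factor]
    rfl
  simp_rw [hNg', hN', Finset.sum_mul, Finset.mul_sum]
  rw [Finset.sum_comm]
  conv_rhs => rw [Finset.sum_comm]
  refine Finset.sum_congr rfl fun j _ => ?_
  by_cases hj : j ∉ V ∧ U = insert j V
  · simp_rw [if_pos hj]
    have e1 : (∑ X, (koszulSign V j : R) * Wg j T X * M X S) =
        (koszulSign V j : R) * (Wg j * M) T S := by
      rw [Matrix.mul_apply, Finset.mul_sum]
      refine Finset.sum_congr rfl fun X _ => ?_
      ring
    have e2 : (∑ X, M T X * ((koszulSign V j : R) * W j X S)) =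
        (koszulSign V j : R) * (M * W j) T S := by
      rw [Matrix.mul_apply, Finset.mul_sum]
      refine Finset.sum_congr rfl fun X _ => ?_
      ring
    rw [e1, e2, key]
  · simp_rw [if_neg hj, zero_mul, mul_zero]

/-- **Step 2 (pairs; the wrap `Λ^m ⊗ Λ^m ≃ Λ^0 ⊗ Λ^0` as a row operation).** With `E` the identity
matrix whose row `(∅,∅)` is replaced by the unit row at `(univ,univ)`, `𝕄 = M(G) ⊗ 1` and
`𝔻 = diag(det G at (∅,∅), 1 elsewhere)`: `E 𝕄 = (𝕄 𝔻) E` (`m ≥ 1`). [folklore] -/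
private theorem pairWrapRow_mul_minor (hm : 1 ≤ m) {G : Matrix (Fin m) (Fin m) R}
    {M : Matrix (Finset (Fin m)) (Finset (Fin m)) R}
    {MM E D : Matrix (Finset (Fin m) × Finset (Fin m)) (Finset (Fin m) × Finset (Fin m)) R}
    (hM : ∀ X Y, M X Y = if h : X.card = Y.card then
      (G.submatrix (X.orderEmbOfFin rfl) (Y.orderEmbOfFin h.symm)).det else 0)
    (hMM : ∀ P Q, MM P Q = M P.1 Q.1 * if P.2 = Q.2 then 1 else 0)
    (hE : ∀ P Q, E P Q = if P = (∅, ∅) then (if Q = (univ, univ) then 1 else 0)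
      else (if P = Q then 1 else 0))
    (hD : D = Matrix.diagonal fun P => if P = (∅, ∅) then G.det else 1) :
    E * MM = MM * D * E := by
  classical
  have hne : (∅ : Finset (Fin m)) ≠ univ := by
    haveI : Nonempty (Fin m) := ⟨⟨0, hm⟩⟩
    exact Finset.univ_nonempty.ne_empty.symm
  have hsrcsnk : ((∅, ∅) : Finset (Fin m) × Finset (Fin m)) ≠ (univ, univ) :=
    fun h => hne (Prod.ext_iff.1 h).1
  -- `𝕄` against the source and the sink
  have hMsrc : ∀ P : Finset (Fin m) × Finset (Fin m), MM P (∅, ∅) = if P = (∅, ∅) then 1 else 0 := by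
    intro P
    rw [hMM]
    by_cases hP : P = (∅, ∅)
    · rw [if_pos hP, hP, minor_empty_empty hM, if_pos rfl, mul_one]
    · rw [if_neg hP]
      by_cases h2 : P.2 = ∅
      · have h1 : P.1 ≠ ∅ := fun h1 => hP (Prod.ext h1 h2)
        rw [minor_of_card_ne hM (by rwa [Finset.card_empty, ne_eq, Finset.card_eq_zero]), zero_mul]
      · rw [if_neg h2, mul_zero]
  have hMsrc' : ∀ Q : Finset (Fin m) × Finset (Fin m), MM (∅, ∅) Q = if Q = (∅, ∅) then 1 else 0 := by
    intro Q
    rw [hMM]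
    by_cases hQ : Q = (∅, ∅)
    · rw [if_pos hQ, hQ, minor_empty_empty hM, if_pos rfl, mul_one]
    · rw [if_neg hQ]
      by_cases h2 : (∅ : Finset (Fin m)) = Q.2
      · have h1 : Q.1 ≠ ∅ := fun h1 => hQ (Prod.ext h1 h2.symm)
        rw [minor_of_card_ne hM (by
          rw [Finset.card_empty]; exact fun h => h1 (Finset.card_eq_zero.mp h.symm)), zero_mul]
      · rw [if_neg h2, mul_zero]
  have hMsnk : ∀ Q : Finset (Fin m) × Finset (Fin m),
      MM (univ, univ) Q = if Q = (univ, univ) then G.det else 0 := by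
    intro Q
    rw [hMM]
    by_cases hQ : Q = (univ, univ)
    · rw [if_pos hQ, hQ, minor_univ_univ hM, if_pos rfl, mul_one]
    · rw [if_neg hQ]
      by_cases h2 : (univ : Finset (Fin m)) = Q.2
      · have h1 : Q.1 ≠ univ := fun h1 => hQ (Prod.ext h1 h2.symm)
        rw [minor_of_card_ne hM (fun h => h1 ?_), zero_mul]
        exact Finset.eq_univ_of_card _ (by rw [← h, Finset.card_univ])
      · rw [if_neg h2, mul_zero]
  ext P Q
  have hL : (E * MM) P Q = if P = (∅, ∅) then MM (univ, univ) Q else MM P Q := by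
    rw [Matrix.mul_apply]
    simp_rw [hE]
    split_ifs with hP <;> simp [Finset.sum_ite_eq', Finset.sum_ite_eq]
  have hR : (MM * D * E) P Q =
      MM P (∅, ∅) * G.det * (if Q = (univ, univ) then 1 else 0) +
        (if Q = (∅, ∅) then 0 else MM P Q) := by
    rw [Matrix.mul_apply]
    have hterm : ∀ X, (MM * D) P X * E X Q =
        (if X = (∅, ∅) then MM P (∅, ∅) * G.det * (if Q = (univ, univ) then 1 else 0) else 0) +
          (if X = Q then (if Q = (∅, ∅) then 0 else MM P Q) else 0) := by
      intro X
      rw [hD, Matrix.mul_diagonal, hE]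
      by_cases hX : X = (∅, ∅)
      · subst hX
        by_cases hQ : Q = (∅, ∅)
        · subst hQ
          simp [hsrcsnk]
        · simp [Ne.symm hQ]
      · by_cases hXQ : X = Q
        · subst hXQ
          simp [hX]
        · simp [hX, hXQ]
    simp_rw [hterm]
    rw [Finset.sum_add_distrib, Finset.sum_ite_eq', Finset.sum_ite_eq']
    simp
  rw [hL, hR, hMsrc]
  by_cases hP : P = (∅, ∅)
  · subst hP
    rw [if_pos rfl, if_pos rfl, one_mul, hMsnk, hMsrc']
    by_cases hQ : Q = (univ, univ)
    · subst hQ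
      simp [Ne.symm hsrcsnk]
    · rw [if_neg hQ, if_neg hQ, mul_zero, zero_add]
      split_ifs <;> rfl
  · rw [if_neg hP, if_neg hP, zero_mul, zero_mul, zero_add]
    split_ifs with hQ
    · subst hQ
      rw [hMsrc, if_neg hP]
    · rfl

/-- **Step 3.** `E (a + N(Gx)) 𝕄 = (𝕄 𝔻) (E (a + N(x)))` for any matrix `a` commuting with `𝕄`.
[folklore] -/
private theorem pairWrapArcs_mul_minor {ι : Type*} [Fintype ι] [DecidableEq ι]
    {MM N Ng E D Z : Matrix ι ι R} (h0 : Z * MM = MM * Z)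
    (h1 : Ng * MM = MM * N) (h2 : E * MM = MM * D * E) :
    E * (Z + Ng) * MM = MM * D * (E * (Z + N)) := by
  rw [Matrix.mul_assoc, Matrix.add_mul, h0, h1, ← Matrix.mul_add, ← Matrix.mul_assoc, h2,
    Matrix.mul_assoc]

/-- **Step 4 (block extraction, pairs).** Restricting to the balanced proper pairs
(`|S₁| = |S₂|`, `S₁ ≠ univ`): the off-diagonal blocks of `𝕄` and `𝕄 𝔻` against the complement
vanish, so Step 3 restricts to the blocks. [folklore] -/
private theorem pairBlock_mul_minor {G : Matrix (Fin m) (Fin m) R}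
    {M : Matrix (Finset (Fin m)) (Finset (Fin m)) R}
    {MM N Ng E D Z : Matrix (Finset (Fin m) × Finset (Fin m)) (Finset (Fin m) × Finset (Fin m)) R}
    (hM : ∀ X Y, M X Y = if h : X.card = Y.card then
      (G.submatrix (X.orderEmbOfFin rfl) (Y.orderEmbOfFin h.symm)).det else 0)
    (hMM : ∀ P Q, MM P Q = M P.1 Q.1 * if P.2 = Q.2 then 1 else 0)
    (hD : D = Matrix.diagonal fun P => if P = (∅, ∅) then G.det else 1)
    (h : E * (Z + Ng) * MM = MM * D * (E * (Z + N))) :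
    (E * (Z + Ng)).toSquareBlockProp (fun P => P.1.card = P.2.card ∧ P.1 ≠ univ) *
        MM.toSquareBlockProp (fun P => P.1.card = P.2.card ∧ P.1 ≠ univ) =
      (MM * D).toSquareBlockProp (fun P => P.1.card = P.2.card ∧ P.1 ≠ univ) *
        (E * (Z + N)).toSquareBlockProp (fun P => P.1.card = P.2.card ∧ P.1 ≠ univ) := by
  classical
  -- `𝕄 P Q = 0` unless `|P.1| = |Q.1|` and `P.2 = Q.2`; then `P` is balanced proper iff `Q` is
  have hvanish : ∀ P Q : Finset (Fin m) × Finset (Fin m),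
      (P.1.card = P.2.card ∧ P.1 ≠ univ) → ¬(Q.1.card = Q.2.card ∧ Q.1 ≠ univ) →
        MM P Q = 0 ∧ MM Q P = 0 := by
    intro P Q hP hQ
    by_cases h2 : P.2 = Q.2
    · have hc : P.1.card ≠ Q.1.card := by
        intro hc
        apply hQ
        refine ⟨by rw [← hc, hP.1, h2], fun hu => hP.2 ?_⟩
        exact Finset.eq_univ_of_card _ (by rw [hc, hu, Finset.card_univ])
      exact ⟨by rw [hMM, minor_of_card_ne hM hc, zero_mul],
        by rw [hMM, minor_of_card_ne hM (Ne.symm hc), zero_mul]⟩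
    · exact ⟨by rw [hMM, if_neg h2, mul_zero], by rw [hMM, if_neg (Ne.symm h2), mul_zero]⟩
  have hoff₁ : MM.toBlock (fun P => ¬(P.1.card = P.2.card ∧ P.1 ≠ univ))
      (fun P => P.1.card = P.2.card ∧ P.1 ≠ univ) = 0 := by
    ext ⟨P, hP⟩ ⟨Q, hQ⟩
    rw [Matrix.toBlock_apply, Matrix.zero_apply]
    exact (hvanish Q P hQ hP).2
  have hoff₂ : (MM * D).toBlock (fun P => P.1.card = P.2.card ∧ P.1 ≠ univ)
      (fun P => ¬(P.1.card = P.2.card ∧ P.1 ≠ univ)) = 0 := by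
    ext ⟨P, hP⟩ ⟨Q, hQ⟩
    rw [Matrix.toBlock_apply, Matrix.zero_apply, hD, Matrix.mul_diagonal, (hvanish P Q hP hQ).1,
      zero_mul]
  have key := congrArg (fun X => Matrix.toBlock X
    (fun P : Finset (Fin m) × Finset (Fin m) => P.1.card = P.2.card ∧ P.1 ≠ univ)
    (fun P : Finset (Fin m) × Finset (Fin m) => P.1.card = P.2.card ∧ P.1 ≠ univ)) h
  have e1 := Matrix.toBlock_mul_eq_add
    (fun P : Finset (Fin m) × Finset (Fin m) => P.1.card = P.2.card ∧ P.1 ≠ univ)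
    (fun P => P.1.card = P.2.card ∧ P.1 ≠ univ) (fun P => P.1.card = P.2.card ∧ P.1 ≠ univ)
    (E * (Z + Ng)) MM
  have e2 := Matrix.toBlock_mul_eq_add
    (fun P : Finset (Fin m) × Finset (Fin m) => P.1.card = P.2.card ∧ P.1 ≠ univ)
    (fun P => P.1.card = P.2.card ∧ P.1 ≠ univ) (fun P => P.1.card = P.2.card ∧ P.1 ≠ univ)
    (MM * D) (E * (Z + N))
  rw [hoff₁, Matrix.mul_zero, add_zero] at e1
  rw [hoff₂, Matrix.zero_mul, add_zero] at e2
  change (E * (Z + Ng)).toBlock _ _ * MM.toBlock _ _ = (MM * D).toBlock _ _ * (E * (Z + N)).toBlock _ _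
  rw [← e1, ← e2, key]

end PairLattice

/-! ### Prop. 2.17's matrix as the block of `E (c + N(x))` -/

section Shape

variable {m : ℕ} {R : Type*} [CommRing R]

/-- A matrix on `FullIdx m` with Prop. 2.17's shape (diagonal `a` at levels `≥ 1`, arc entries
`ε(S₁,i) ε(S₂,j) v i j` in row `(wrap (S₁ ∪ i), wrap (S₂ ∪ j))`, column `(S₁, S₂)`) is the block,
on the balanced proper pairs, of `E (a·1 + N)`, where `N` is the arc matrix of the lattice of all
pairs of subsets with the same arc entries and `E` replaces the row of `(∅, ∅)` by the row of
`(univ, univ)` (the identification `ΛᵐE ⊗ ΛᵐF* ≃ Λ⁰E ⊗ Λ⁰F*`). [folklore] -/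
private theorem fullShape_eq_block {v : Fin m → Fin m → R} {a : R}
    {B : Matrix (FullIdx m) (FullIdx m) R}
    {N E : Matrix (Finset (Fin m) × Finset (Fin m)) (Finset (Fin m) × Finset (Fin m)) R}
    (hB : ∀ T S, B T S = (if T = S ∧ S.1.1.Nonempty then a else 0) +
      ∑ i, ∑ j, if i ∉ S.1.1 ∧ j ∉ S.1.2 ∧ T.1.1 = wrap m (insert i S.1.1) ∧
          T.1.2 = wrap m (insert j S.1.2)
        then (koszulSign S.1.1 i : R) * (koszulSign S.1.2 j : R) * v i j else 0)
    (hN : ∀ X Y, N X Y = ∑ i, ∑ j, if i ∉ Y.1 ∧ j ∉ Y.2 ∧ X = (insert i Y.1, insert j Y.2) then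
      (koszulSign Y.1 i : R) * (koszulSign Y.2 j : R) * v i j else 0)
    (hE : ∀ P Q, E P Q = if P = (∅, ∅) then (if Q = (univ, univ) then 1 else 0)
      else (if P = Q then 1 else 0)) :
    B = (E * (Matrix.diagonal (fun _ => a) + N)).toSquareBlockProp
      fun P => P.1.card = P.2.card ∧ P.1 ≠ univ := by
  classical
  refine Matrix.ext fun T S => ?_
  -- balanced pairs: the second component is empty / full iff the first is
  have hT2e : T.1.2 = ∅ ↔ T.1.1 = ∅ := by
    rw [← Finset.card_eq_zero, ← T.2.1, Finset.card_eq_zero]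
  have hT2u : T.1.2 ≠ univ := by
    intro h
    apply T.2.2
    exact Finset.eq_univ_of_card _ (by rw [T.2.1, h, Finset.card_univ])
  have hSsnk : ¬((univ, univ) = S.1) := fun h => S.2.2 (Prod.ext_iff.1 h).1.symm
  rw [Matrix.toSquareBlockProp_def, Matrix.of_apply, Matrix.mul_apply, hB]
  have hEsum : ∀ X : Finset (Fin m) × Finset (Fin m) → R,
      (∑ V, E T.1 V * X V) = if T.1 = (∅, ∅) then X (univ, univ) else X T.1 := by
    intro X
    simp_rw [hE]
    split_ifs with hT <;> simp [Finset.sum_ite_eq, Finset.sum_ite_eq']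
  rw [hEsum (fun V => (Matrix.diagonal (fun _ : Finset (Fin m) × Finset (Fin m) => a) + N) V S.1)]
  by_cases hT : T.1.1 = ∅
  · have hT' : T.1 = (∅, ∅) := Prod.ext hT (hT2e.2 hT)
    rw [if_pos hT', Matrix.add_apply, Matrix.diagonal_apply_ne _ hSsnk, zero_add, hN]
    have h1 : ¬(T = S ∧ S.1.1.Nonempty) := by
      rintro ⟨rfl, hS⟩
      exact hS.ne_empty hT
    rw [if_neg h1, zero_add]
    refine Finset.sum_congr rfl fun i _ => Finset.sum_congr rfl fun j _ => ?_
    have hw1 : ∀ Z : Finset (Fin m), Z ≠ ∅ → ((∅ : Finset (Fin m)) = wrap m Z ↔ univ = Z) := by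
      intro Z hZ
      unfold wrap
      split_ifs with h
      · exact ⟨fun _ => h.symm, fun _ => rfl⟩
      · exact ⟨fun h' => absurd h'.symm hZ, fun h' => absurd h'.symm h⟩
    have hwi := hw1 (insert i S.1.1) (Finset.insert_ne_empty i _)
    have hwj := hw1 (insert j S.1.2) (Finset.insert_ne_empty j _)
    rw [hT, hT2e.2 hT]
    simp only [hwi, hwj, Prod.mk.injEq]
  · have hT2 : T.1.2 ≠ ∅ := fun h => hT (hT2e.1 h)
    have hT' : ¬(T.1 = (∅, ∅)) := fun h => hT (Prod.ext_iff.1 h).1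
    rw [if_neg hT', Matrix.add_apply, Matrix.diagonal_apply, hN]
    congr 1
    · have hiff : (T = S ∧ S.1.1.Nonempty) ↔ T.1 = S.1 := by
        constructor
        · rintro ⟨rfl, -⟩
          rfl
        · intro h
          exact ⟨Subtype.ext h, Finset.nonempty_iff_ne_empty.mpr (by rw [← h]; exact hT)⟩
      simp only [hiff]
    · refine Finset.sum_congr rfl fun i _ => Finset.sum_congr rfl fun j _ => ?_
      have hw2 : ∀ (Tc Z : Finset (Fin m)), Tc ≠ ∅ → Tc ≠ univ → (Tc = wrap m Z ↔ Tc = Z) := by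
        intro Tc Z hT0 hTu
        unfold wrap
        split_ifs with h
        · exact ⟨fun h' => absurd h' hT0, fun h' => absurd (h'.trans h) hTu⟩
        · exact Iff.rfl
      simp only [hw2 _ _ hT T.2.2, hw2 _ _ hT2 hT2u, Prod.ext_iff]

end Shape

/-! ### The substitutions `g ⊗ 1` and `transp` on Prop. 2.17's matrix -/

section Subst

variable {k : Type*} [CommRing k] {m : ℕ}

/-- Left multiplication `x ↦ g ⊗ 1 · x`: the column `x_{•j}` is multiplied by `gᵀ`. [folklore] -/
private theorem linSubst_kronecker_one_X (g : Matrix (Fin m) (Fin m) k) (i j : Fin m) :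
    linSubst (Fin m × Fin m) k (g ⊗ₖ (1 : Matrix (Fin m) (Fin m) k)) (X (i, j)) =
      ((Matrix.transpose g).map (C : k →+* MvPolynomial (Fin m × Fin m) k)).mulVec
        (fun l => X (l, j)) i := by
  classical
  rw [linSubst_X, Matrix.mulVec, dotProduct, Fintype.sum_prod_type]
  refine Finset.sum_congr rfl fun l _ => ?_
  simp_rw [Matrix.kronecker_apply, Matrix.one_apply, mul_ite, mul_one, mul_zero, ite_smul,
    zero_smul, Finset.sum_ite_eq', Finset.mem_univ, if_true]
  rw [Matrix.map_apply, Matrix.transpose_apply, MvPolynomial.smul_eq_C_mul]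

/-- The entries of `Ã(g ⊗ 1 · x)`: Prop. 2.17's shape with `x_{•j}` replaced by `gᵀ x_{•j}`.
[folklore] -/
private theorem linSubstEntries_detFullMatrix_apply {γ : GL (Fin m × Fin m) k}
    {g : Matrix (Fin m) (Fin m) k}
    (hγ : (γ : Matrix (Fin m × Fin m) (Fin m × Fin m) k) = g ⊗ₖ (1 : Matrix (Fin m) (Fin m) k))
    (c : k) (T S : FullIdx m) :
    Matrix.linSubstEntries γ (detFullMatrix k m c) T S =
      (if T = S ∧ S.1.1.Nonempty then C c else 0) +
        ∑ i, ∑ j, if i ∉ S.1.1 ∧ j ∉ S.1.2 ∧ T.1.1 = wrap m (insert i S.1.1) ∧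
            T.1.2 = wrap m (insert j S.1.2) then
          (koszulSign S.1.1 i : MvPolynomial (Fin m × Fin m) k) *
            (koszulSign S.1.2 j : MvPolynomial (Fin m × Fin m) k) *
            ((Matrix.transpose g).map (C : k →+* MvPolynomial (Fin m × Fin m) k)).mulVec
              (fun l => X (l, j)) i else 0 := by
  rw [Matrix.linSubstEntries, Matrix.map_apply, hγ, detFullMatrix, Matrix.of_apply, map_add, map_sum]
  congr 1
  · split_ifs
    · exact linSubst_C _ _ _ _
    · exact map_zero _
  · refine Finset.sum_congr rfl fun i _ => ?_
    rw [map_sum]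
    refine Finset.sum_congr rfl fun j _ => ?_
    split_ifs
    · rw [map_mul, linSubst_C, linSubst_kronecker_one_X, Int.cast_mul, map_mul, map_intCast,
        map_intCast]
    · exact map_zero _

/-- The entries of `Ã(x)` itself in the same normal form. [folklore] -/
private theorem detFullMatrix_apply' (c : k) (T S : FullIdx m) :
    detFullMatrix k m c T S =
      (if T = S ∧ S.1.1.Nonempty then C c else 0) +
        ∑ i, ∑ j, if i ∉ S.1.1 ∧ j ∉ S.1.2 ∧ T.1.1 = wrap m (insert i S.1.1) ∧
            T.1.2 = wrap m (insert j S.1.2) then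
          (koszulSign S.1.1 i : MvPolynomial (Fin m × Fin m) k) *
            (koszulSign S.1.2 j : MvPolynomial (Fin m × Fin m) k) * X (i, j) else 0 := by
  rw [detFullMatrix, Matrix.of_apply]
  simp_rw [Int.cast_mul, map_mul, map_intCast]

/-- The transposition substitution swaps the indices: `x_{pq} ↦ x_{qp}`. [folklore] -/
private theorem linSubst_transpose_X (i j : Fin m) :
    linSubst (Fin m × Fin m) k (Equiv.Perm.permMatrix k (Equiv.prodComm (Fin m) (Fin m))) (X (i, j)) =
      X (j, i) := by
  rw [linSubst_permMatrix, rename_X]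
  rfl

variable (m) in
/-- The swap `(S₁, S₂) ↦ (S₂, S₁)` of the index set `FullIdx m` (the bijection between the bases of
`ΛʲE ⊗ ΛʲF*` and `ΛʲF* ⊗ ΛʲE`, p0013:L99–L104). [cite: LandsbergRessayre2017, Prop. 2.17] -/
private theorem swapIdx_wd (p : FullIdx m) :
    (p.1.2, p.1.1).1.card = (p.1.2, p.1.1).2.card ∧ (p.1.2, p.1.1).1 ≠ univ := by
  refine ⟨p.2.1.symm, fun h => p.2.2 ?_⟩
  exact Finset.eq_univ_of_card _ (by rw [p.2.1, show p.1.2 = univ from h, Finset.card_univ])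

/-- **`Ã(xᵀ)` is `Ã(x)` with rows and columns relabelled by the swap** `(S₁,S₂) ↦ (S₂,S₁)`
("there exist two permutation matrices `B₁, B₂` such that `Ã(Mᵀ) = B₁ Ã(M) B₂⁻¹`",
p0013:L105–L109). [cite: LandsbergRessayre2017, Prop. 2.17] -/
private theorem detFullMatrix_map_transpose (c : k) (T S : FullIdx m) :
    linSubst (Fin m × Fin m) k (Equiv.Perm.permMatrix k (Equiv.prodComm (Fin m) (Fin m)))
        (detFullMatrix k m c T S) =
      detFullMatrix k m c ⟨(T.1.2, T.1.1), swapIdx_wd m T⟩ ⟨(S.1.2, S.1.1), swapIdx_wd m S⟩ := by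
  rw [detFullMatrix, Matrix.of_apply, Matrix.of_apply, map_add, map_sum]
  congr 1
  · have hiff : (T = S ∧ S.1.1.Nonempty) ↔
        ((⟨(T.1.2, T.1.1), swapIdx_wd m T⟩ : FullIdx m) = ⟨(S.1.2, S.1.1), swapIdx_wd m S⟩ ∧
          S.1.2.Nonempty) := by
      rw [Subtype.ext_iff, Subtype.ext_iff, Prod.ext_iff, Prod.ext_iff, ← Finset.card_pos,
        ← Finset.card_pos, S.2.1]
      simp only
      tauto
    split_ifs with h1 h2 h2
    · exact linSubst_C _ _ _ _
    · exact absurd (hiff.1 h1) h2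
    · exact absurd (hiff.2 h2) h1
    · exact map_zero _
  · rw [Finset.sum_comm]
    refine Finset.sum_congr rfl fun j _ => ?_
    rw [map_sum]
    refine Finset.sum_congr rfl fun i _ => ?_
    have hiff : (j ∉ S.1.1 ∧ i ∉ S.1.2 ∧ T.1.1 = wrap m (insert j S.1.1) ∧
        T.1.2 = wrap m (insert i S.1.2)) ↔
        (i ∉ S.1.2 ∧ j ∉ S.1.1 ∧ T.1.2 = wrap m (insert i S.1.2) ∧
          T.1.1 = wrap m (insert j S.1.1)) := by tauto
    simp only
    by_cases h : j ∉ S.1.1 ∧ i ∉ S.1.2 ∧ T.1.1 = wrap m (insert j S.1.1) ∧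
        T.1.2 = wrap m (insert i S.1.2)
    · rw [if_pos h, if_pos (hiff.1 h), map_mul, linSubst_C, linSubst_transpose_X,
        mul_comm (koszulSign S.1.1 j)]
    · rw [if_neg h, if_neg (fun h' => h (hiff.2 h')), map_zero]

end Subst

/-! ### The exact lifts -/

section Lifts

variable {k : Type*} [Field k] {m : ℕ}

/-- **Lift of a left multiplication.** For `γ = g ⊗ 1` (`g ∈ GL_m`), Prop. 2.17's matrix
(transported along `e`) satisfies `Ã(γ · x) = P Ã(x) Q⁻¹` with `Q = (⊕_j ∧ʲgᵀ) ⊗ 1` on the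
balanced proper pairs and `P = Q · diag(det g at (∅,∅), 1 elsewhere)` — the action of `GL(E)`
through the functorial maps `∧ʲ` (p0013:L62–L71 "these identifications determine
`GL(E) × GL(F)`-equivariant polynomial maps … `GL(E) × GL(F)` belongs to the image of `ρ̄_A`").
[cite: LandsbergRessayre2017, Prop. 2.17] -/
private theorem exists_lift_left (hm : 1 ≤ m) (c : k) {n : ℕ} (e : FullIdx m ≃ Fin n)
    (γ : GL (Fin m × Fin m) k) (g : GL (Fin m) k)
    (hγ : (γ : Matrix (Fin m × Fin m) (Fin m × Fin m) k) =
      (g : Matrix (Fin m) (Fin m) k) ⊗ₖ (1 : Matrix (Fin m) (Fin m) k)) :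
    ∃ P Q : GL (Fin n) k,
      Matrix.linSubstEntries γ (Matrix.reindex e e (detFullMatrix k m c)) =
        (P : Matrix (Fin n) (Fin n) k).map C * Matrix.reindex e e (detFullMatrix k m c) *
          ((Q⁻¹ : GL (Fin n) k) : Matrix (Fin n) (Fin n) k).map C := by
  classical
  -- `Gk = gᵀ` and its inverse
  set Gk : Matrix (Fin m) (Fin m) k := (g : Matrix (Fin m) (Fin m) k)ᵀ with hGk
  set Gk' : Matrix (Fin m) (Fin m) k := ((g⁻¹ : GL (Fin m) k) : Matrix (Fin m) (Fin m) k)ᵀ with hGk'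
  have hGG' : Gk * Gk' = 1 := by
    rw [hGk, hGk', ← Matrix.transpose_mul, ← Units.val_mul, inv_mul_cancel, Units.val_one,
      Matrix.transpose_one]
  have hG'G : Gk' * Gk = 1 := by
    rw [hGk, hGk', ← Matrix.transpose_mul, ← Units.val_mul, mul_inv_cancel, Units.val_one,
      Matrix.transpose_one]
  have hdet : Gk.det * Gk'.det = 1 := by rw [← Matrix.det_mul, hGG', Matrix.det_one]
  -- the block matrices of minors over `k`, mutually inverse (Cauchy–Binet)
  set MkG : Matrix (Finset (Fin m)) (Finset (Fin m)) k := Matrix.of fun X Y =>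
    if h : X.card = Y.card then (Gk.submatrix (X.orderEmbOfFin rfl) (Y.orderEmbOfFin h.symm)).det
    else 0 with hMkG
  set MkG' : Matrix (Finset (Fin m)) (Finset (Fin m)) k := Matrix.of fun X Y =>
    if h : X.card = Y.card then (Gk'.submatrix (X.orderEmbOfFin rfl) (Y.orderEmbOfFin h.symm)).det
    else 0 with hMkG'
  have hMM' : MkG * MkG' = 1 :=
    minor_mul_minor (G := Gk) (H := Gk') (MG := MkG) (MH := MkG') (MGH := 1) (fun _ _ => rfl)
      (fun _ _ => rfl) (fun X Y => by rw [hGG']; exact one_eq_minor_one X Y)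
  have hM'M : MkG' * MkG = 1 :=
    minor_mul_minor (G := Gk') (H := Gk) (MG := MkG') (MH := MkG) (MGH := 1) (fun _ _ => rfl)
      (fun _ _ => rfl) (fun X Y => by rw [hG'G]; exact one_eq_minor_one X Y)
  -- `𝕄 = M ⊗ 1` on the lattice of all pairs of subsets, and its inverse
  set MMk : Matrix (Finset (Fin m) × Finset (Fin m)) (Finset (Fin m) × Finset (Fin m)) k :=
    Matrix.of fun P Q => MkG P.1 Q.1 * if P.2 = Q.2 then 1 else 0 with hMMk
  set MMk' : Matrix (Finset (Fin m) × Finset (Fin m)) (Finset (Fin m) × Finset (Fin m)) k :=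
    Matrix.of fun P Q => MkG' P.1 Q.1 * if P.2 = Q.2 then 1 else 0 with hMMk'
  have hkron : ∀ A B : Matrix (Finset (Fin m)) (Finset (Fin m)) k,
      (Matrix.of fun P Q : Finset (Fin m) × Finset (Fin m) => A P.1 Q.1 * if P.2 = Q.2 then (1 : k) else 0) =
        A ⊗ₖ (1 : Matrix (Finset (Fin m)) (Finset (Fin m)) k) := by
    intro A B
    ext P Q
    rw [Matrix.of_apply, Matrix.kronecker_apply, Matrix.one_apply]
  have hMMkk : MMk * MMk' = 1 := by
    rw [hMMk, hMMk', hkron MkG MkG, hkron MkG' MkG', ← Matrix.mul_kronecker_mul, hMM', Matrix.mul_one,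
      Matrix.one_kronecker_one]
  have hMMkk' : MMk' * MMk = 1 := by
    rw [hMMk, hMMk', hkron MkG MkG, hkron MkG' MkG', ← Matrix.mul_kronecker_mul, hM'M, Matrix.mul_one,
      Matrix.one_kronecker_one]
  -- off-block vanishing (balanced proper pairs against the rest)
  have hvanish : ∀ (A : Matrix (Finset (Fin m)) (Finset (Fin m)) k)
      (hA0 : ∀ X Y : Finset (Fin m), X.card ≠ Y.card → A X Y = 0)
      (P Q : Finset (Fin m) × Finset (Fin m)),
      (P.1.card = P.2.card ∧ P.1 ≠ univ) → ¬(Q.1.card = Q.2.card ∧ Q.1 ≠ univ) →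
        (A P.1 Q.1 * if P.2 = Q.2 then (1 : k) else 0) = 0 ∧
          (A Q.1 P.1 * if Q.2 = P.2 then (1 : k) else 0) = 0 := by
    intro A hA0 P Q hP hQ
    by_cases h2 : P.2 = Q.2
    · have hc : P.1.card ≠ Q.1.card := by
        intro hc
        apply hQ
        refine ⟨by rw [← hc, hP.1, h2], fun hu => hP.2 ?_⟩
        exact Finset.eq_univ_of_card _ (by rw [hc, hu, Finset.card_univ])
      exact ⟨by rw [hA0 _ _ hc, zero_mul], by rw [hA0 _ _ (Ne.symm hc), zero_mul]⟩
    · exact ⟨by rw [if_neg h2, mul_zero], by rw [if_neg (Ne.symm h2), mul_zero]⟩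
  have hMkG0 : ∀ X Y : Finset (Fin m), X.card ≠ Y.card → MkG X Y = 0 := fun X Y h =>
    minor_of_card_ne (fun _ _ => rfl) h
  have hMkG'0 : ∀ X Y : Finset (Fin m), X.card ≠ Y.card → MkG' X Y = 0 := fun X Y h =>
    minor_of_card_ne (fun _ _ => rfl) h
  have hoffG : MMk.toBlock (fun P => ¬(P.1.card = P.2.card ∧ P.1 ≠ univ))
      (fun P => P.1.card = P.2.card ∧ P.1 ≠ univ) = 0 := by
    ext ⟨P, hP⟩ ⟨Q, hQ⟩
    rw [Matrix.toBlock_apply, Matrix.zero_apply, hMMk, Matrix.of_apply]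
    exact (hvanish MkG hMkG0 Q P hQ hP).2
  have hoffG' : MMk'.toBlock (fun P => ¬(P.1.card = P.2.card ∧ P.1 ≠ univ))
      (fun P => P.1.card = P.2.card ∧ P.1 ≠ univ) = 0 := by
    ext ⟨P, hP⟩ ⟨Q, hQ⟩
    rw [Matrix.toBlock_apply, Matrix.zero_apply, hMMk', Matrix.of_apply]
    exact (hvanish MkG' hMkG'0 Q P hQ hP).2
  -- the blocks `Q = (⊕_{j<m} ∧ʲgᵀ) ⊗ 1` and `Q'` on `FullIdx m`
  set Qk : Matrix (FullIdx m) (FullIdx m) k :=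
    MMk.toSquareBlockProp (fun P => P.1.card = P.2.card ∧ P.1 ≠ univ) with hQk
  set Qk' : Matrix (FullIdx m) (FullIdx m) k :=
    MMk'.toSquareBlockProp (fun P => P.1.card = P.2.card ∧ P.1 ≠ univ) with hQk'
  have hone : (1 : Matrix (Finset (Fin m) × Finset (Fin m)) (Finset (Fin m) × Finset (Fin m)) k).toSquareBlockProp
      (fun P => P.1.card = P.2.card ∧ P.1 ≠ univ) = 1 :=
    Matrix.toBlock_one_self _
  have hQQ' : Qk * Qk' = 1 := by
    rw [hQk, hQk', ← toSquareBlockProp_mul_of_lowerLeft _ _ _ hoffG', hMMkk, hone]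
  have hQ'Q : Qk' * Qk = 1 := by
    rw [hQk, hQk', ← toSquareBlockProp_mul_of_lowerLeft _ _ _ hoffG, hMMkk', hone]
  -- the diagonal `D = diag(det gᵀ at (∅,∅), 1 elsewhere)` on all pairs and on the block
  set Dfull : Matrix (Finset (Fin m) × Finset (Fin m)) (Finset (Fin m) × Finset (Fin m)) k :=
    Matrix.diagonal fun P => if P = (∅, ∅) then Gk.det else 1 with hDfull
  set Dk : Matrix (FullIdx m) (FullIdx m) k :=
    Matrix.diagonal fun S => if S.1 = (∅, ∅) then Gk.det else 1 with hDk
  set Dk' : Matrix (FullIdx m) (FullIdx m) k :=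
    Matrix.diagonal fun S => if S.1 = (∅, ∅) then Gk'.det else 1 with hDk'
  have hDblock : Dfull.toSquareBlockProp (fun P => P.1.card = P.2.card ∧ P.1 ≠ univ) = Dk := by
    rw [hDfull, hDk]
    exact Matrix.toBlock_diagonal_self _ _
  have hoffD : Dfull.toBlock (fun P => ¬(P.1.card = P.2.card ∧ P.1 ≠ univ))
      (fun P => P.1.card = P.2.card ∧ P.1 ≠ univ) = 0 := by
    ext ⟨P, hP⟩ ⟨Q, hQ⟩
    have hPQ : P ≠ Q := fun h => hP (h ▸ hQ)
    rw [Matrix.toBlock_apply, Matrix.zero_apply, hDfull, Matrix.diagonal_apply_ne _ hPQ]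
  have hDD' : Dk * Dk' = 1 := by
    rw [hDk, hDk', Matrix.diagonal_mul_diagonal, ← Matrix.diagonal_one]
    congr 1
    funext S
    split_ifs <;> simp [hdet]
  have hD'D : Dk' * Dk = 1 := by
    rw [hDk, hDk', Matrix.diagonal_mul_diagonal, ← Matrix.diagonal_one]
    congr 1
    funext S
    split_ifs <;> simp [mul_comm Gk'.det, hdet]
  -- the identity over the polynomial ring, on `FullIdx m`
  have key : Matrix.linSubstEntries γ (detFullMatrix k m c) * Qk.map C =
      (Qk * Dk).map C * detFullMatrix k m c := by
    set GR : Matrix (Fin m) (Fin m) (MvPolynomial (Fin m × Fin m) k) :=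
      Gk.map (C : k →+* MvPolynomial (Fin m × Fin m) k) with hGR
    set MR : Matrix (Finset (Fin m)) (Finset (Fin m)) (MvPolynomial (Fin m × Fin m) k) :=
      MkG.map (C : k →+* MvPolynomial (Fin m × Fin m) k) with hMR
    have hMRe : ∀ X Y, MR X Y = if h : X.card = Y.card then
        (GR.submatrix (X.orderEmbOfFin rfl) (Y.orderEmbOfFin h.symm)).det else 0 := by
      intro X Y
      rw [hMR, Matrix.map_apply, hMkG, Matrix.of_apply]
      split_ifs with h
      · rw [hGR, RingHom.map_det, RingHom.mapMatrix_apply, Matrix.submatrix_map]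
      · exact map_zero C
    set MMR : Matrix (Finset (Fin m) × Finset (Fin m)) (Finset (Fin m) × Finset (Fin m))
        (MvPolynomial (Fin m × Fin m) k) :=
      Matrix.of fun P Q => MR P.1 Q.1 * if P.2 = Q.2 then 1 else 0 with hMMR
    set f : Fin m → Fin m → MvPolynomial (Fin m × Fin m) k := fun i j => X (i, j) with hf
    set N : Matrix (Finset (Fin m) × Finset (Fin m)) (Finset (Fin m) × Finset (Fin m))
        (MvPolynomial (Fin m × Fin m) k) :=
      Matrix.of fun X' Y => ∑ i, ∑ j, if i ∉ Y.1 ∧ j ∉ Y.2 ∧ X' = (insert i Y.1, insert j Y.2) then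
        (koszulSign Y.1 i : MvPolynomial (Fin m × Fin m) k) *
          (koszulSign Y.2 j : MvPolynomial (Fin m × Fin m) k) * f i j else 0 with hN
    set Ng : Matrix (Finset (Fin m) × Finset (Fin m)) (Finset (Fin m) × Finset (Fin m))
        (MvPolynomial (Fin m × Fin m) k) :=
      Matrix.of fun X' Y => ∑ i, ∑ j, if i ∉ Y.1 ∧ j ∉ Y.2 ∧ X' = (insert i Y.1, insert j Y.2) then
        (koszulSign Y.1 i : MvPolynomial (Fin m × Fin m) k) *
          (koszulSign Y.2 j : MvPolynomial (Fin m × Fin m) k) * GR.mulVec (fun l => f l j) i else 0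
      with hNg
    set E : Matrix (Finset (Fin m) × Finset (Fin m)) (Finset (Fin m) × Finset (Fin m))
        (MvPolynomial (Fin m × Fin m) k) :=
      Matrix.of fun P Q => if P = (∅, ∅) then
        (if Q = (univ, univ) then (1 : MvPolynomial (Fin m × Fin m) k) else 0)
        else (if P = Q then 1 else 0) with hE
    set DR : Matrix (Finset (Fin m) × Finset (Fin m)) (Finset (Fin m) × Finset (Fin m))
        (MvPolynomial (Fin m × Fin m) k) :=
      Matrix.diagonal fun P => if P = (∅, ∅) then GR.det else 1 with hDR
    set Z : Matrix (Finset (Fin m) × Finset (Fin m)) (Finset (Fin m) × Finset (Fin m))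
        (MvPolynomial (Fin m × Fin m) k) := Matrix.diagonal fun _ => C c with hZ
    have h0 : Z * MMR = MMR * Z := by
      ext P Q
      rw [hZ, Matrix.diagonal_mul, Matrix.mul_diagonal, mul_comm]
    have h1 := pairArcs_mul_minor hMRe f (MM := MMR) (N := N) (Ng := Ng) (fun _ _ => rfl)
      (fun _ _ => rfl) (fun _ _ => rfl)
    have h2 := pairWrapRow_mul_minor hm hMRe (MM := MMR) (E := E) (D := DR) (fun _ _ => rfl)
      (fun _ _ => rfl) hDR
    have h4 := pairBlock_mul_minor hMRe (MM := MMR) (fun _ _ => rfl) hDR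
      (pairWrapArcs_mul_minor h0 h1 h2)
    -- Prop. 2.17's matrix and its substituted version as blocks
    have hA : detFullMatrix k m c =
        (E * (Z + N)).toSquareBlockProp (fun P => P.1.card = P.2.card ∧ P.1 ≠ univ) :=
      fullShape_eq_block (v := f) (a := C c) (fun T S => detFullMatrix_apply' c T S) (fun _ _ => rfl)
        (fun _ _ => rfl)
    have hAγ : Matrix.linSubstEntries γ (detFullMatrix k m c) =
        (E * (Z + Ng)).toSquareBlockProp (fun P => P.1.card = P.2.card ∧ P.1 ≠ univ) :=
      fullShape_eq_block (v := fun i j => GR.mulVec (fun l => f l j) i) (a := C c)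
        (fun T S => linSubstEntries_detFullMatrix_apply hγ c T S) (fun _ _ => rfl) (fun _ _ => rfl)
    -- the blocks of `MMR` and `MMR DR`
    have hMMRmap : MMR = MMk.map (C : k →+* MvPolynomial (Fin m × Fin m) k) := by
      ext P Q
      rw [hMMR, Matrix.of_apply, Matrix.map_apply, hMMk, Matrix.of_apply, map_mul, hMR,
        Matrix.map_apply]
      split_ifs
      · rw [map_one]
      · rw [map_zero]
    have hQR : MMR.toSquareBlockProp (fun P => P.1.card = P.2.card ∧ P.1 ≠ univ) =
        Qk.map (C : k →+* MvPolynomial (Fin m × Fin m) k) := by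
      rw [hMMRmap]
      rfl
    have hDRmap : DR = Dfull.map (C : k →+* MvPolynomial (Fin m × Fin m) k) := by
      rw [hDR, hDfull, Matrix.diagonal_map (map_zero _)]
      congr 1
      funext P
      split_ifs
      · rw [hGR, RingHom.map_det, RingHom.mapMatrix_apply]
      · rw [map_one]
    have hPD : (MMR * DR).toSquareBlockProp (fun P => P.1.card = P.2.card ∧ P.1 ≠ univ) =
        (Qk * Dk).map (C : k →+* MvPolynomial (Fin m × Fin m) k) := by
      have hprod : MMR * DR = (MMk * Dfull).map (C : k →+* MvPolynomial (Fin m × Fin m) k) := by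
        rw [hMMRmap, hDRmap, Matrix.map_mul]
      rw [hprod, ← hDblock, hQk, ← toSquareBlockProp_mul_of_lowerLeft _ _ _ hoffD]
      rfl
    rw [hAγ, hA, ← hQR, ← hPD]
    exact h4
  -- units on `FullIdx m`, then transported to `Fin n`
  have hrr : ∀ A B : Matrix (FullIdx m) (FullIdx m) k,
      Matrix.reindex e e A * Matrix.reindex e e B = Matrix.reindex e e (A * B) := fun A B =>
    Matrix.submatrix_mul_equiv A B e.symm e.symm e.symm
  have hr1 : Matrix.reindex e e (1 : Matrix (FullIdx m) (FullIdx m) k) = 1 :=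
    Matrix.submatrix_one_equiv _
  refine ⟨⟨Matrix.reindex e e (Qk * Dk), Matrix.reindex e e (Dk' * Qk'), ?_, ?_⟩,
    ⟨Matrix.reindex e e Qk, Matrix.reindex e e Qk', ?_, ?_⟩, ?_⟩
  · rw [hrr, Matrix.mul_assoc, ← Matrix.mul_assoc Dk, hDD', Matrix.one_mul, hQQ', hr1]
  · rw [hrr, Matrix.mul_assoc, ← Matrix.mul_assoc Qk', hQ'Q, Matrix.one_mul, hD'D, hr1]
  · rw [hrr, hQQ', hr1]
  · rw [hrr, hQ'Q, hr1]
  · change Matrix.reindex e e (Matrix.linSubstEntries γ (detFullMatrix k m c)) =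
      (Matrix.reindex e e (Qk * Dk)).map C * Matrix.reindex e e (detFullMatrix k m c) *
        (Matrix.reindex e e Qk').map C
    have key' : Matrix.linSubstEntries γ (detFullMatrix k m c) =
        (Qk * Dk).map C * detFullMatrix k m c * Qk'.map C := by
      rw [← key, Matrix.mul_assoc, ← Matrix.map_mul, hQQ', Matrix.map_one C (map_zero C) (map_one C),
        Matrix.mul_one]
    have hrrR : ∀ A B : Matrix (FullIdx m) (FullIdx m) (MvPolynomial (Fin m × Fin m) k),
        Matrix.reindex e e A * Matrix.reindex e e B = Matrix.reindex e e (A * B) := fun A B =>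
      Matrix.submatrix_mul_equiv A B e.symm e.symm e.symm
    rw [key']
    change _ = Matrix.reindex e e ((Qk * Dk).map C) * Matrix.reindex e e (detFullMatrix k m c) *
      Matrix.reindex e e (Qk'.map C)
    rw [hrrR, hrrR]

/-- **Lift of the transposition.** `Ã(xᵀ)` is `Ã(x)` relabelled by the swap `(S₁,S₂) ↦ (S₂,S₁)`,
so after transport along `e` it is `P_α Ã P_α⁻¹` for a permutation matrix `P_α`
(p0013:L105–L109). [cite: LandsbergRessayre2017, Prop. 2.17] -/
private theorem exists_lift_transpose (c : k) {n : ℕ} (e : FullIdx m ≃ Fin n)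
    (γ : GL (Fin m × Fin m) k)
    (hγ : (γ : Matrix (Fin m × Fin m) (Fin m × Fin m) k) =
      Equiv.Perm.permMatrix k (Equiv.prodComm (Fin m) (Fin m))) :
    ∃ P Q : GL (Fin n) k,
      Matrix.linSubstEntries γ (Matrix.reindex e e (detFullMatrix k m c)) =
        (P : Matrix (Fin n) (Fin n) k).map C * Matrix.reindex e e (detFullMatrix k m c) *
          ((Q⁻¹ : GL (Fin n) k) : Matrix (Fin n) (Fin n) k).map C := by
  classical
  -- the swap of `FullIdx m` and the induced permutation of `Fin n`
  let ρ : Equiv.Perm (FullIdx m) :=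
    { toFun := fun p => ⟨(p.1.2, p.1.1), swapIdx_wd m p⟩
      invFun := fun p => ⟨(p.1.2, p.1.1), swapIdx_wd m p⟩
      left_inv := fun p => rfl
      right_inv := fun p => rfl }
  let α : Equiv.Perm (Fin n) := (e.symm.trans ρ).trans e
  have hA : Matrix.linSubstEntries γ (Matrix.reindex e e (detFullMatrix k m c)) =
      (Matrix.reindex e e (detFullMatrix k m c)).submatrix α α := by
    have hαi : ∀ i, α i = e (ρ (e.symm i)) := fun i => rfl
    refine Matrix.ext fun i j => ?_
    rw [Matrix.linSubstEntries, Matrix.map_apply, hγ, Matrix.reindex_apply, Matrix.submatrix_apply,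
      Matrix.submatrix_apply, Matrix.submatrix_apply, detFullMatrix_map_transpose, hαi i, hαi j,
      e.symm_apply_apply, e.symm_apply_apply]
    rfl
  let Pu : GL (Fin n) k :=
    ⟨α.permMatrix k, α⁻¹.permMatrix k,
      by rw [← Matrix.permMatrix_mul, inv_mul_cancel, Matrix.permMatrix_one],
      by rw [← Matrix.permMatrix_mul, mul_inv_cancel, Matrix.permMatrix_one]⟩
  refine ⟨Pu, Pu, ?_⟩
  have hPmap : ∀ σ : Equiv.Perm (Fin n), (σ.permMatrix k).map (C : k →+* MvPolynomial (Fin m × Fin m) k) =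
      σ.permMatrix (MvPolynomial (Fin m × Fin m) k) := by
    intro σ
    refine Matrix.ext fun i j => ?_
    simp only [Matrix.map_apply, PEquiv.toMatrix_apply]
    split_ifs
    · exact map_one _
    · exact map_zero _
  rw [hA, show ((Pu⁻¹ : GL (Fin n) k) : Matrix (Fin n) (Fin n) k) = α⁻¹.permMatrix k from rfl,
    show ((Pu : GL (Fin n) k) : Matrix (Fin n) (Fin n) k) = α.permMatrix k from rfl, hPmap, hPmap,
    Equiv.Perm.permMatrix, Equiv.Perm.permMatrix, PEquiv.toMatrix_toPEquiv_mul,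
    PEquiv.mul_toMatrix_toPEquiv, Matrix.submatrix_submatrix]
  rfl

end Lifts

/-! ### The realised symmetry group: `GL(F)` is conjugate to `GL(E)` by the transposition -/

section Group

variable (k : Type*) [Field k] (m : ℕ)

/-- The permutation matrix of the transposition conjugates `h ⊗ 1` into `1 ⊗ h`:
`P_τ (A ⊗ B) P_τ = B ⊗ A` for `τ = prodComm`. [folklore] -/
private theorem permMatrix_prodComm_mul_kronecker_mul (A B : Matrix (Fin m) (Fin m) k) :
    Equiv.Perm.permMatrix k (Equiv.prodComm (Fin m) (Fin m)) * (A ⊗ₖ B) *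
        Equiv.Perm.permMatrix k (Equiv.prodComm (Fin m) (Fin m)) = B ⊗ₖ A := by
  rw [Equiv.Perm.permMatrix, PEquiv.toMatrix_toPEquiv_mul, PEquiv.mul_toMatrix_toPEquiv]
  ext ⟨a, b⟩ ⟨c', d⟩
  simp only [Matrix.submatrix_apply, id, Matrix.kronecker_apply]
  rw [show (Equiv.prodComm (Fin m) (Fin m)) (a, b) = (b, a) from rfl,
    show (Equiv.prodComm (Fin m) (Fin m)).symm (c', d) = (d, c') from rfl, Matrix.kronecker_apply,
    mul_comm]

/-- `P_τ² = 1` for the transposition permutation. [folklore] -/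
private theorem permMatrix_prodComm_mul_self :
    Equiv.Perm.permMatrix k (Equiv.prodComm (Fin m) (Fin m)) *
        Equiv.Perm.permMatrix k (Equiv.prodComm (Fin m) (Fin m)) = 1 := by
  rw [← Matrix.permMatrix_mul, show (Equiv.prodComm (Fin m) (Fin m) : Equiv.Perm (Fin m × Fin m)) *
      Equiv.prodComm (Fin m) (Fin m) = 1 from Equiv.ext fun p => rfl, Matrix.permMatrix_one]

/-- **`𝔾_{det_m}` is generated by `GL(E)` and the transposition**: the realised symmetry group
`detSymmetrySubst k m` (generated by `GL(E)`, `GL(F)` and `transp`, p0003:L56–L59) is contained in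
the subgroup generated by the left multiplications `g ⊗ 1` and the transposition, because
`1 ⊗ h = τ (h ⊗ 1) τ`. [cite: LandsbergRessayre2017, §1 (𝔾_{det_n})] -/
theorem detSymmetrySubst_le_closure_left_transpose :
    detSymmetrySubst k m ≤ Subgroup.closure
      ({γ : GL (Fin m × Fin m) k | ∃ g : GL (Fin m) k,
          (γ : Matrix (Fin m × Fin m) (Fin m × Fin m) k) =
            (g : Matrix (Fin m) (Fin m) k) ⊗ₖ (1 : Matrix (Fin m) (Fin m) k)} ∪
        transposeSubstSet k m) := by
  classical
  set H : Subgroup (GL (Fin m × Fin m) k) := Subgroup.closure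
      ({γ : GL (Fin m × Fin m) k | ∃ g : GL (Fin m) k,
          (γ : Matrix (Fin m × Fin m) (Fin m × Fin m) k) =
            (g : Matrix (Fin m) (Fin m) k) ⊗ₖ (1 : Matrix (Fin m) (Fin m) k)} ∪
        transposeSubstSet k m) with hH
  -- the transposition as a unit, a member of `H` with `τ² = 1`
  let τu : GL (Fin m × Fin m) k :=
    ⟨Equiv.Perm.permMatrix k (Equiv.prodComm (Fin m) (Fin m)),
      Equiv.Perm.permMatrix k (Equiv.prodComm (Fin m) (Fin m)),
      permMatrix_prodComm_mul_self k m, permMatrix_prodComm_mul_self k m⟩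
  have hτ : τu ∈ H := Subgroup.subset_closure (Or.inr rfl)
  have hττ : τu * τu = 1 := Units.ext (permMatrix_prodComm_mul_self k m)
  have hleft : leftLinearSubst k m ≤ H := by
    unfold leftLinearSubst
    exact Subgroup.closure_mono Set.subset_union_left
  have hright : rightLinearSubst k m ≤ H := by
    unfold rightLinearSubst
    rw [Subgroup.closure_le]
    rintro δ ⟨h, hδ⟩
    have hδ' : τu * δ * τu ∈ H := by
      refine Subgroup.subset_closure (Or.inl ⟨h, ?_⟩)
      rw [Units.val_mul, Units.val_mul, hδ]
      exact permMatrix_prodComm_mul_kronecker_mul k m 1 (h : Matrix (Fin m) (Fin m) k)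
    have hδeq : δ = τu * (τu * δ * τu) * τu := by
      rw [← mul_assoc, ← mul_assoc, hττ, one_mul, mul_assoc, hττ, mul_one]
    change δ ∈ H
    rw [hδeq]
    exact H.mul_mem (H.mul_mem hτ hδ') hτ
  unfold detSymmetrySubst
  rw [Subgroup.closure_le]
  rintro γ ((hγ | hγ) | hγ)
  · exact hleft hγ
  · exact hright hγ
  · exact Subgroup.subset_closure (Or.inr hγ)

end Group

/-! ### Equivariance and the discharge of `lr_prop_2_17` -/

section Equivariance

variable {k : Type*} [Field k] {m : ℕ}

/-- **Prop. 2.17, second half: `Ã` RESPECTS `𝔾_{det_m}`.** For every field `k`, `m ≥ 1`, `c ≠ 0`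
and every indexing `e : FullIdx m ≃ Fin n`, Prop. 2.17's matrix with scalar `c` on `Λ₀`,
transported along `e`, is an affine determinantal representation of
`(-1)^{m+1} c^{n-m} m! · det_m` with exact `GL_n × GL_n` lifts of all of `detSymmetrySubst k m`
(`GL(E) × GL(F)` through `∧ʲ`, the transposition through the swap of the two tensor factors;
p0013:L62–L109). [cite: LandsbergRessayre2017, Prop. 2.17] -/
theorem isEquivariantDetRepr_detFullMatrix (hm : 1 ≤ m) {c : k} (hc : c ≠ 0) {n : ℕ}
    (e : FullIdx m ≃ Fin n) :
    IsEquivariantDetRepr (detSymmetrySubst k m)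
      (C ((-1) ^ (m + 1) * c ^ ((2 * m).choose m - 1 - m) * (m.factorial : k)) * detPoly (Fin m) k)
      (Matrix.reindex e e (detFullMatrix k m c)) := by
  refine IsEquivariantDetRepr.anti ?_ (detSymmetrySubst_le_closure_left_transpose k m)
  refine IsEquivariantDetRepr.of_generators (isRegularDetRepr_detFullMatrix k hm hc e).1 ?_
  rintro γ (⟨g, hγ⟩ | hγ)
  · exact exists_lift_left hm c e γ g hγ
  · exact exists_lift_transpose c e γ hγ

end Equivariance

end LR17

/-! ### The printed scalar `(m!)^{-1/(n-m)}` and the discharge -/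

section Discharge

/-- `m + 2 ≤ C(2m, m)` for `m ≥ 2` (`C(2m,1) = 2m ≤ C(2m,m)`). [folklore] -/
private theorem LR17.add_two_le_choose {m : ℕ} (hm : 2 ≤ m) : m + 2 ≤ (2 * m).choose m := by
  have h1 : (2 * m).choose 1 ≤ (2 * m).choose (2 * m / 2) := Nat.choose_le_middle 1 (2 * m)
  rw [Nat.choose_one_right, Nat.mul_div_cancel_left m (by norm_num)] at h1
  omega

/-- **The printed scalar does its job**: `((m!)^{-1/(n-m)})^{n-m} · m! = 1` in `ℂ`, `n = C(2m,m) - 1`,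
`m ≥ 1` (for `m = 1`, `n = m` and the scalar is `1`). [cite: LandsbergRessayre2017, Prop. 2.17] -/
theorem LR17.lamScale_pow_mul_factorial {m : ℕ} (hm : 1 ≤ m) :
    (LR17.lamScale m : ℂ) ^ ((2 * m).choose m - 1 - m) * (m.factorial : ℂ) = 1 := by
  have hreal : (LR17.lamScale m) ^ ((2 * m).choose m - 1 - m) * (m.factorial : ℝ) = 1 := by
    unfold LR17.lamScale
    have hf : (0 : ℝ) < (m.factorial : ℝ) := by exact_mod_cast Nat.factorial_pos m
    rcases Nat.lt_or_ge m 2 with h | h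
    · have hm1 : m = 1 := by omega
      subst hm1
      norm_num
    · have hN : (2 * m).choose m - 1 - m ≠ 0 := by
        have := LR17.add_two_le_choose h
        omega
      rw [← Real.rpow_natCast, ← Real.rpow_mul hf.le,
        show -(1 : ℝ) / (((2 * m).choose m - 1 - m : ℕ) : ℝ) * (((2 * m).choose m - 1 - m : ℕ) : ℝ) =
          -1 from by
            rw [div_mul_cancel₀]
            exact_mod_cast hN,
        Real.rpow_neg_one, inv_mul_cancel₀ hf.ne']
  have := congrArg (fun x : ℝ => (x : ℂ)) hreal
  push_cast at this
  exact this

/-- The printed scalar is non-zero. [cite: LandsbergRessayre2017, Prop. 2.17] -/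
theorem LR17.lamScale_ne_zero (m : ℕ) : (LR17.lamScale m : ℂ) ≠ 0 := by
  have hf : (0 : ℝ) < (m.factorial : ℝ) := by exact_mod_cast Nat.factorial_pos m
  exact_mod_cast (Real.rpow_pos_of_pos hf _).ne'

/-- **Discharge of the named fact `lr_prop_2_17`** (LR17 Prop. 2.17, p0007:L81–L93): for every
`m ≥ 1` and every bijection `e : LR17.FullIdx m ≃ Fin n`, `LR17.detFullMatrix ℂ m ((m!)^{-1/(n-m)})`
transported along `e` is a REGULAR affine determinantal representation of `(-1)^{m+1} det_m` that
RESPECTS the realised symmetry group `detSymmetrySubst ℂ m = 𝔾_{det_m}` (exact lifts).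
[cite: LandsbergRessayre2017, Prop. 2.17] -/
theorem lr_prop_2_17_holds : lr_prop_2_17 := by
  intro m hm n e
  have hc := LR17.lamScale_ne_zero m
  have h1 := LR17.isRegularDetRepr_detFullMatrix ℂ hm hc e
  have h2 := LR17.isEquivariantDetRepr_detFullMatrix hm hc e
  rw [mul_assoc, LR17.lamScale_pow_mul_factorial hm, mul_one] at h1 h2
  exact ⟨h1, h2⟩

/-- **Thm. 2.13, upper half, unconditionally**: `srdc(det_m) ≤ C(2m,m) - 1`, i.e. `det_m` has a
regular `𝔾_{det_m}`-equivariant determinantal representation of size `C(2m,m) - 1` (`m ≥ 1`)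
(p0006:L127–L129, from Prop. 2.17 via `lr_thm_2_13_le`). [cite: LandsbergRessayre2017, Thm. 2.13] -/
theorem LR17.hasRegularEquivariantDetRepr_detPoly_full {m : ℕ} (hm : 1 ≤ m) :
    HasRegularEquivariantDetRepr (detSymmetrySubst ℂ m) (detPoly (Fin m) ℂ) ((2 * m).choose m - 1) :=
  lr_thm_2_13_le lr_prop_2_17_holds hm

/-- **Thm. 2.13 as an equality, modulo the lower bound only**: given the named fact `lr_thm_2_13_ge`
(the representation-theoretic lower bound, whose proof the paper omits as "very similar" to that of
Thm. 2.1), `srdc(det_m) = C(2m,m) - 1` for `m ≥ 1` (p0006:L127–L129).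
[cite: LandsbergRessayre2017, Thm. 2.13] -/
theorem LR17.regularEquivariantDetComplexity_detPoly_full_eq (hge : lr_thm_2_13_ge) {m : ℕ}
    (hm : 1 ≤ m) :
    regularEquivariantDetComplexity (detSymmetrySubst ℂ m) (detPoly (Fin m) ℂ) = (2 * m).choose m - 1 :=
  lr_thm_2_13_eq lr_prop_2_17_holds hge hm

end Discharge

end Literature.Computability.AlgebraicComplexity

end
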